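import Literature.MathematicalPhysics.QuantumFieldTheory.Balaban1983to89.B3Ineq210RegularRegion
import Literature.MathematicalPhysics.QuantumFieldTheory.Balaban1983to89.B1Ineq225RegularBox

/-!
# Bałaban, *(Higgs)₂,₃ quantum fields in a finite volume III* [B3] — (2.10) p. 426 AT A REGULAR NON-CONSTANT BACKGROUND `B̃ = A`
ON A CELL-PRODUCT BOX OF BIG BLOCKS `Ω ⊆ T_η`, AT **EVERY** PAIR OF POINTS (no `R₀`-margin), PROVED for a concrete carrier of
`B3Sect2StatementsPart2.ScaledKernels`

statement-level skeleton of published theorems with citation tags; proofs where landed; nothing here is a claim about the Yang–Mills mass gap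

T. Bałaban, Commun. Math. Phys. **88** (1983) 411–445 [cite: Balaban1983Higgs3]; inputs from part I, Commun. Math. Phys. **85** (1982)
603–636 [cite: Balaban1982Higgs1], as landed in the tree.  PDF held: `paper:balaban1983-higgs-2-3-quantum-fields-finite-volume` p. 426
[PDF 16]; `paper:balaban1982-cmp85-higgs23-i` pp. 610–611 [PDF 8–9].

CITATION HEADER (lean-in-tree rule).  Cell `lit-balaban` (HOME `run/shared/lean/pub/lit-balaban/`), Phase-2 proof seat **p35** gen 21
(unit `lit-balaban-p35`, free-target protocol G.5-34(d), TAKING HOME/STATUS 2026-08-23T00:55Z); SKELETON row **B3.Eq2.10** (owner r15,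
head `proved`; this file is a LOCATED MEMBER — the parallelepiped clause of Prop. I.2.1 p. 611 carried into (2.10)); the input named for the
box step of r14 g19's programme on the analytic half of (1.16) (`lit-balaban-r14/DESIGN-B3-116-analytic.md` §2: chain bookkeeping sums
intermediate sites over ALL of `Ω`, so (2.10) is needed without the interior margin).  Companion of r14 g17's `B3Ineq210RegularRegion`
(big-block unions, INTERIOR points) and `B3Ineq210RegularTorus` (`Ω = T_η`, odd `L`).

## What is printed (p. 426 [PDF 16], verbatim)

*"For the propagators G^η_{(j)} we apply the inequality |G^η_{(j)}(Ω, B̃; x, x′)| ≤ O(1)(L^jη)^{−d+2}e^{−δ₁(L^jη)^{−1}|x−x′|}, (2.10)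
and if the propagator is differentiated, then for each differentiation, there is an additional factor (L^jη)^{−1} on the right
side. … They all are obtained by rescaling from the η-lattice to the L^{−j}-lattice and application of Propositions I.2.1 and I.2.3."*
[Balaban1982Higgs1] p. 611 [PDF 9] l.1–2, verbatim: *«For some simple sets Ω, e.g. for rectangular parallelepipeds, the inequalities hold
without any restrictions on the points x, x′.»*

## What this file proves, and how

The route of `B3Ineq210RegularRegion` verbatim — pieces (2.6) = (I.2.43) for the region operators (`pieceR`, `sum_pieceR`), the piece
bounds `absG_pieceR_zero_le` / `absG_pieceR_pos_le` with the predicate `good := (· ∈ Ω)` (EVERY point of the box is good), the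
(I.2.34) input on `Ω^{(l)} × Ω^{(l)}` (p35 g16 `B1Prop23RegularRegionSmall.prop23_regular_region_small`, no margin there) — with ONE change:
the (I.2.25) inputs are p35 g15's `R₀`-FREE box members `B1Ineq225RegularBox.norm_propagatorK_box_reg_decay` (value, EVERY site) and
`norm_covDeriv_propagatorK_box_reg_decay` (derivative, EVERY bond with both ends in `Ω`), block-summed here to arbitrary sources (§1) and read
at every level `l ≤ k` through the cell refinement `cellBox k K₀ S = cellBox l K₀ S′` (§0).  Because the derivative member lives on the
bonds INSIDE `Ω` (the Neumann operator's bonds) and not on all bonds issuing from a good site, §2 re-runs r14's derivative sandwich engine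
with a BOND hypothesis (`b₋, b₊ ∈ Ω`) in place of the site predicate (`norm_covDeriv_sandwichR_cb_le_B`, `absDG_pieceR_zero_le_B`,
`absDG_pieceR_pos_le_B`; proofs = r14's, hypothesis shape changed).  §3: **`ineq210_regularBox_explicit_small`** — (2.10) for every piece
`j`, value clause at EVERY `x, x′ ∈ Ω`, derivative clause at every bond `⟨x, x+εe_μ⟩ ⊂ Ω` and every `x′ ∈ Ω`, ONE smallness parameter
`L^kδ_A·|e| ≤ t`, every charge, every `L ≥ 2`; the carrier `regBoxKernels` on the subtype `{x // x ∈ Ω}` and **`ineq210_regularBox_small`**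
(`Ineq210 δ₁ C` for it); `cellBox_univ` (the full torus is a box — so this file also re-derives the every-point torus statement).

## Dictionary and honest scope

`Ω = cellBox k K₀ S` = `{x : ⌊x_μ/(L^kK₀)⌋ ∈ S_μ ∀μ}` for arbitrary index sets `S_μ` (every product of intervals of big blocks, also wrapping
the torus; one big block; the whole torus); `dist = ε|x − x′|`; `absG j x x′ = ε^{−d}Σ_{i′}‖(G^η_{(j)}(Ω,A)e_{(x′,i′)})(x)‖` — the kernel of the
`j`-th piece of (2.6) for the region operators at ALL points of `Ω`; `absDG j μ x x′` its covariant derivative (I.1.7) in the row variable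
at the bond `⟨x, x+εe_μ⟩` WHEN that bond lies in `Ω`, and `0` (nothing claimed) when `x+εe_μ ∉ Ω` — the Neumann operator of `Ω` has no such
bond.  NOT covered: regions that are not cell products (general big-block unions: `B3Ineq210RegularRegion`, interior points); `m² = 0`;
volumes with `K₀ ∤ M` or fewer than three cubes a side; the fields of (2.5), (2.11), (2.12) (carrier fields `0`); constants depend on `K₀`
and are chosen after the charge data (quantifier shape of the cited inputs).  No `def … : Prop` fact, no new named fact; axioms standard.
-/

noncomputable section

open scoped BigOperators InnerProductSpace

namespace Literature.MathematicalPhysics.QuantumFieldTheory.Balaban1983to89.B3Ineq210RegularBox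

open HiggsLattice (ChargeData ScalarField siteInner covDeriv)
open HiggsCovariance (propagatorK avgQkLin avgQkAdj E)
open HiggsAveraging (blockIter blockK mem_blockK toFinest)
open HiggsFluctMeasure (coeff221)
open B1Eq221Coordinates (fieldCoord)
open B1Eq230FluctCov (mat Ix cb fluctCovA cb_repr mat_comp)
open B2Eq255Concrete (cutTo cutToLin cutTo_of_mem cutTo_of_not_mem)
open B1Ineq234Concrete (rho profile profile_nonneg' nCol tdist_blockIter_le_real)
open B1TorusCubeCover (half half_pos)
open B1TorusCubeLocality26 (rS)
open B1TorusRegionHSizes (IsBigBlockUnion)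
open B1TorusRegionRop (chi)
open B1Cor23RegularRegion (propagatorK_indicator_comm)
open B3Sect2StatementsPart2 (ScaledKernels)
open B3Ineq210RegularTorus (norm_avgQkAdj_cb_le blockIter_eq_of_avgQkAdj_cb_ne_zero blockDist_le_tdist sum3_le exp_blockIter_le
  norm_apply_le_sum_coord norm_covDeriv_apply_le_sum_coord abs_mat_le_norm norm_cb_le mesh_eq_pow_mul card_Ix eq_of_cb_ne_zero
  aSeq_sq_le covDeriv_smul'' covDeriv_zero'' mesh_mono cst210 cst210_pos le_cst210_zero le_cst210_zero' le_cst210_pos le_cst210_pos')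
open B3Ineq210RegularRegion (half_eq_half_mul isBigBlockUnion_of_le blockUnion_of_isBigBlockUnion levelSet pieceR pieceR_zero
  pieceR_of_pos pieceR_of_le sandwichR absG_pieceR_zero_le absG_pieceR_pos_le absG_pieceR_ge_eq_zero absDG_pieceR_ge_eq_zero
  reg223R_of_small propagatorK_apply_eq_chi towerR pieceF_towerR levelSet_blockUnion mat_condCov232_levelSet G_avgQkAdj_cb_eq_zero
  abs_coord_CQG_le_R sum_CQG_le_R half_mono)
open B1Ineq225RegularBox (cellOf cellBox mem_cellBox isBigBlockUnion_cellBox)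
open B1Ineq225RegularRegion (blockPiece sum_blockPiece blockPiece_supported norm_blockPiece_apply_le)
open B1Ineq225DerivRegularRegion (covDeriv_sum' covDeriv_zero')
open B2Eq230CondShiftBound (sum_exp_neg_tdist_le)
open B4Sect5Proof (latticeConst latticeConst_nonneg)
open scoped Matrix

variable {P : HiggsLattice.Params} {N : ℕ}

/-! ## §0 Cell-product boxes at lower levels: `cellBox k K₀ S = cellBox l K₀ S′` for `l ≤ k` -/

section Cells

variable {k K₀ l : ℕ}

/-- The refined index sets: a cell of side `L^lK₀` with index `c` lies in the cell of side `L^kK₀` with index `⌊c/L^{k−l}⌋`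
(`l ≤ k`); the range bound `|T_ε|_μ` only makes the set finite. [cite: Balaban1983RegularityDecay, §2 p.575 «a sum of large blocks»]
[cite: Balaban1982Higgs1, Prop. 2.1 p.611 l.1–2] -/
def refineS (P : HiggsLattice.Params) (k l : ℕ) (S : Fin P.d → Finset ℕ) : Fin P.d → Finset ℕ :=
  fun μ => (Finset.range (P.sitesPerDir 0 μ)).filter fun c => c / P.L ^ (k - l) ∈ S μ

/-- **A cell-product box of `L^kK₀`-cells IS a cell-product box of `L^lK₀`-cells for every `l ≤ k`** (the cells refine).
[cite: Balaban1983RegularityDecay, §2 p.575] [cite: Balaban1982Higgs1, Prop. 2.1 p.611 l.1–2] -/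
theorem cellBox_eq_cellBox_of_le (hl : l ≤ k) (S : Fin P.d → Finset ℕ) :
    cellBox k K₀ S = cellBox l K₀ (refineS P k l S) := by
  ext x
  rw [mem_cellBox, mem_cellBox]
  refine forall_congr' fun μ => ?_
  unfold cellOf refineS
  rw [Finset.mem_filter, Finset.mem_range, Nat.div_div_eq_div_mul, ← half_eq_half_mul P hl K₀]
  constructor
  · intro h
    exact ⟨lt_of_le_of_lt (Nat.div_le_self _ _) (ZMod.val_lt _), h⟩
  · exact fun h => h.2

/-- The full torus is a cell-product box (all cell indices admitted): with `S_μ = [0, |T_ε|_μ)`.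
[cite: Balaban1982Higgs1, Prop. 2.1 p.611 («The same considerations apply to Ω = T^{(k)}_1»)] -/
theorem cellBox_univ (k K₀ : ℕ) :
    cellBox k K₀ (fun μ => Finset.range (P.sitesPerDir 0 μ)) = (Finset.univ : Finset (HiggsLattice.Site P 0)) := by
  ext x
  simp only [Finset.mem_univ, iff_true, mem_cellBox, Finset.mem_range]
  intro μ
  unfold cellOf
  exact lt_of_le_of_lt (Nat.div_le_self _ _) (ZMod.val_lt _)

/-- Membership in a cell-product box depends on the `l`-block only, every `l ≤ k`.
[cite: Balaban1983RegularityDecay, §2 p.575] -/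
theorem cellBox_blockUnion (hl : l ≤ k) (S : Fin P.d → Finset ℕ) :
    ∀ x x' : HiggsLattice.Site P 0, blockIter l x = blockIter l x' → (x ∈ cellBox k K₀ S ↔ x' ∈ cellBox k K₀ S) :=
  blockUnion_of_isBigBlockUnion hl (isBigBlockUnion_cellBox S)

end Cells

/-! ## §1 The `R₀`-free box members of (I.2.25), block-summed to arbitrary sources -/

section BoxSum

/-- `K_d(δ) > 0`. [cite: Balaban1983RegularityDecay, Sect. 5 Theorem p.594] -/
private theorem latticeConst_pos' {d : ℕ} (hd : 1 ≤ d) {δ : ℝ} (hδ : 0 < δ) : 0 < latticeConst d δ := by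
  unfold latticeConst
  apply pow_pos
  have hdr : (0 : ℝ) < d := by exact_mod_cast hd
  have h1 : Real.exp (-(δ / d)) < 1 := Real.exp_lt_one_iff.2 (by have := div_pos hδ hdr; linarith)
  have h2 : 0 < 1 - Real.exp (-(δ / d)) := by linarith
  positivity

/-- The distance from `x` to the block `B^K(b)`, `D_b = max(D, L^K(|x_K − b| − 1))`, is below `|x − z|` for every `z ∈ B^K(b)` at distance
`≥ D`. [cite: Balaban1983RegularityDecay, (2.21)–(2.22) pp.578–579] -/
private theorem blockDist_le {K : ℕ} (hK : K ≤ P.K) (x : HiggsLattice.Site P 0) (b : HiggsLattice.Site P K) (g : ScalarField P 0 N)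
    {D : ℝ} (hD : ∀ z, g z ≠ 0 → D ≤ (HiggsLattice.Site.tdist x z : ℝ)) :
    ∀ z, blockPiece K b g z ≠ 0 →
      max D ((P.L : ℝ) ^ K * ((HiggsLattice.Site.tdist (blockIter K x) b : ℝ) - 1)) ≤ (HiggsLattice.Site.tdist x z : ℝ) := by
  intro z hz
  have hLK : (0 : ℝ) < (P.L : ℝ) ^ K := pow_pos (by exact_mod_cast P.hL) K
  have hzb : blockIter K z = b := by
    by_contra h
    exact hz (by unfold blockPiece; rw [if_neg h])
  have hgz : g z ≠ 0 := fun h0 => hz (by unfold blockPiece; rw [if_pos hzb, h0])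
  refine max_le (hD z hgz) ?_
  have h1 := tdist_blockIter_le_real hK x z
  rw [hzb] at h1
  rw [mul_sub, mul_one, sub_le_iff_le_add]
  have h2 : (P.L : ℝ) ^ K * (HiggsLattice.Site.tdist (blockIter K x) b : ℝ)
      ≤ (P.L : ℝ) ^ K * ((HiggsLattice.Site.tdist x z : ℝ) / (P.L : ℝ) ^ K + 1 - ((P.L : ℝ) ^ K)⁻¹) :=
    mul_le_mul_of_nonneg_left h1 hLK.le
  have e : (P.L : ℝ) ^ K * ((HiggsLattice.Site.tdist x z : ℝ) / (P.L : ℝ) ^ K + 1 - ((P.L : ℝ) ^ K)⁻¹)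
      = (HiggsLattice.Site.tdist x z : ℝ) + (P.L : ℝ) ^ K - 1 := by field_simp
  rw [e] at h2
  linarith

/-- The rate bookkeeping of the block summation: `e^{−D_b/(2K₀L^K)} ≤ e^{−D/(4K₀L^K)}·e^{1/(4K₀)}·e^{−|x_K − b|/(4K₀)}`.
[cite: Balaban1983RegularityDecay, (2.21)–(2.22) pp.578–579] -/
private theorem exp_blockDist_split {K K₀ : ℕ} (hK₀ : (0 : ℝ) < K₀) (x : HiggsLattice.Site P 0) (b : HiggsLattice.Site P K) {D : ℝ} :
    Real.exp (-(max D ((P.L : ℝ) ^ K * ((HiggsLattice.Site.tdist (blockIter K x) b : ℝ) - 1)) / (2 * K₀ * (P.L : ℝ) ^ K)))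
      ≤ Real.exp (-(D / (4 * K₀ * (P.L : ℝ) ^ K))) * Real.exp (1 / (4 * K₀)) *
          Real.exp (-(1 / (4 * K₀) * (HiggsLattice.Site.tdist (blockIter K x) b : ℝ))) := by
  have hLK : (0 : ℝ) < (P.L : ℝ) ^ K := pow_pos (by exact_mod_cast P.hL) K
  set Db : ℝ := max D ((P.L : ℝ) ^ K * ((HiggsLattice.Site.tdist (blockIter K x) b : ℝ) - 1)) with hDb
  rw [← Real.exp_add, ← Real.exp_add]
  refine Real.exp_le_exp.2 ?_
  have hmax : D + (P.L : ℝ) ^ K * ((HiggsLattice.Site.tdist (blockIter K x) b : ℝ) - 1) ≤ 2 * Db := by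
    rw [two_mul]; exact add_le_add (le_max_left _ _) (le_max_right _ _)
  have hK4 : (0 : ℝ) < 4 * K₀ * (P.L : ℝ) ^ K := by positivity
  have key : (D + (P.L : ℝ) ^ K * ((HiggsLattice.Site.tdist (blockIter K x) b : ℝ) - 1)) / (4 * K₀ * (P.L : ℝ) ^ K)
      ≤ Db / (2 * K₀ * (P.L : ℝ) ^ K) :=
    calc (D + (P.L : ℝ) ^ K * ((HiggsLattice.Site.tdist (blockIter K x) b : ℝ) - 1)) / (4 * K₀ * (P.L : ℝ) ^ K)
        ≤ 2 * Db / (4 * K₀ * (P.L : ℝ) ^ K) := div_le_div_of_nonneg_right hmax hK4.le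
      _ = Db / (2 * K₀ * (P.L : ℝ) ^ K) := by field_simp; ring
  have e1 : (D + (P.L : ℝ) ^ K * ((HiggsLattice.Site.tdist (blockIter K x) b : ℝ) - 1)) / (4 * K₀ * (P.L : ℝ) ^ K)
      = D / (4 * K₀ * (P.L : ℝ) ^ K) - 1 / (4 * K₀) + 1 / (4 * K₀) * (HiggsLattice.Site.tdist (blockIter K x) b : ℝ) := by
    field_simp
    ring
  rw [e1] at key
  linarith

/-- A block piece over an empty block vanishes. [cite: Balaban1983RegularityDecay, (2.21) p.578] -/
private theorem blockPiece_eq_zero_of_empty {K : ℕ} (b : HiggsLattice.Site P K) (g : ScalarField P 0 N)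
    (hb : ¬ ∃ y₀ : HiggsLattice.Site P 0, blockIter K y₀ = b) : blockPiece K b g = 0 := by
  funext y
  unfold blockPiece
  rw [if_neg (fun h => hb ⟨y, h⟩)]
  rfl

set_option maxHeartbeats 800000 in
/-- **PROP. 2.1 (2.25), VALUE MEMBER, FOR CELL-PRODUCT BOXES OF BIG BLOCKS WITHOUT `R₀`, ARBITRARY `g`** — p35 g15's
`B1Ineq225RegularBox.norm_propagatorK_box_reg_decay` (sources in one `K`-block, EVERY site `x`, no margin) summed over the `K`-blocks exactly
as `B1Ineq225RegularRegion.norm_propagatorK_region_reg_decay_sum`: for EVERY `g` with `‖g‖_∞ ≤ M′` vanishing at the sites within distance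
`< D` of `x`, `‖(G^ε_K(Ω, A)1_Ωg)(x)‖ ≤ c₀(K₀)(L^Kε)²·e^{−D/(4K₀L^K)}·M′`, `Ω = cellBox K K₀ S`, at every (2.23)-regular `A` on `Ω`.
[cite: Balaban1982Higgs1, Prop. 2.1 (2.23), (2.25) p.610, p.611 l.1–2] [cite: Balaban1983RegularityDecay, Theorem (1.10) p.573, pp.574–575,
(2.21)–(2.22) pp.578–579, p.579 L25–28] -/
theorem norm_propagatorK_box_reg_decay_sum (d L : ℕ) (hd : 1 ≤ d) (hL : 2 ≤ L) {a : ℝ} (ha : 0 < a) {msq : ℝ} (hmsq : 0 < msq)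
    (N : ℕ) (C : ChargeData N) (ε₀ : ℝ) (creg β : ℝ) (hcreg : 0 ≤ creg) (hβ : 0 < β) :
    ∃ K₀min : ℕ, ∀ K₀ : ℕ, K₀min ≤ K₀ → ∃ c₀ e₁ : ℝ, 0 < c₀ ∧ 0 < e₁ ∧
      ∀ (P : HiggsLattice.Params), P.d = d → P.L = L → K₀ ∣ P.M →
      ∀ {K : ℕ}, 1 ≤ K → K ≤ P.K → (∀ μ, 3 * half P K K₀ ≤ P.sitesPerDir 0 μ) → P.mesh K ≤ ε₀ →
      ∀ (S : Fin P.d → Finset ℕ) (A : HiggsLattice.VecField P 0) {ec : ℝ}, 0 < ec → ec ≤ e₁ →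
      (∀ z ∈ cellBox K K₀ S, ∀ μ ν : Fin P.d,
          P.mesh K * |C.e| / ec * |A ⟨z.shift μ, ν⟩ - A ⟨z, ν⟩| ≤ creg * ec ^ (β - 1) / (P.L : ℝ) ^ K) →
      ∀ (x : HiggsLattice.Site P 0) (g : ScalarField P 0 N) (M D : ℝ), (∀ y, ‖g y‖ ≤ M) → 0 ≤ D →
          (∀ z, g z ≠ 0 → D ≤ (HiggsLattice.Site.tdist x z : ℝ)) →
            ‖propagatorK C (cellBox K K₀ S) A msq a K (chi (cellBox K K₀ S) • g) x‖
              ≤ c₀ * P.mesh K ^ 2 * Real.exp (-(D / (4 * K₀ * (P.L : ℝ) ^ K))) * M := by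
  obtain ⟨c₀, hc₀, K₀min, hmain⟩ :=
    B1Ineq225RegularBox.norm_propagatorK_box_reg_decay d L hd hL ha hmsq N C ε₀ creg β hcreg hβ
  refine ⟨max K₀min 1, fun K₀ hK₀ => ?_⟩
  have hK₀1 : 1 ≤ K₀ := le_trans (le_max_right _ _) hK₀
  have hK₀r : (0 : ℝ) < K₀ := by exact_mod_cast hK₀1
  obtain ⟨e₁, he₁, hblk⟩ := hmain K₀ (le_trans (le_max_left _ _) hK₀)
  have hrate : (0 : ℝ) < 1 / (4 * K₀) := by positivity
  have hlc : 0 < latticeConst d (1 / (4 * K₀)) := latticeConst_pos' hd hrate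
  refine ⟨c₀ * Real.exp (1 / (4 * K₀)) * latticeConst d (1 / (4 * K₀)), e₁, by positivity, he₁, ?_⟩
  intro P hPd hPL hK₀M K hK1 hK hN3 hε S A ec hec hle hreg x g M D hgM hD0 hD
  subst hPd
  have hM0 : 0 ≤ M := (norm_nonneg _).trans (hgM x)
  have hLK : (0 : ℝ) < (P.L : ℝ) ^ K := pow_pos (by exact_mod_cast P.hL) K
  -- split `g` over the `K`-blocks
  have hsplit : propagatorK C (cellBox K K₀ S) A msq a K (chi (cellBox K K₀ S) • g) x
      = ∑ b : HiggsLattice.Site P K, propagatorK C (cellBox K K₀ S) A msq a K (chi (cellBox K K₀ S) • blockPiece K b g) x := by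
    conv_lhs => rw [← sum_blockPiece (K := K) g]
    rw [Finset.smul_sum, map_sum, Finset.sum_apply]
  rw [hsplit]
  refine (norm_sum_le _ _).trans ?_
  have hpiece : ∀ b : HiggsLattice.Site P K, ‖propagatorK C (cellBox K K₀ S) A msq a K (chi (cellBox K K₀ S) • blockPiece K b g) x‖
      ≤ c₀ * P.mesh K ^ 2 * (Real.exp (-(D / (4 * K₀ * (P.L : ℝ) ^ K))) * Real.exp (1 / (4 * K₀))
          * Real.exp (-(1 / (4 * K₀) * (HiggsLattice.Site.tdist (blockIter K x) b : ℝ)))) * M := by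
    intro b
    classical
    by_cases hb : ∃ y₀, blockIter K y₀ = b
    · obtain ⟨y₀, hy₀⟩ := hb
      have hDb0 : 0 ≤ max D ((P.L : ℝ) ^ K * ((HiggsLattice.Site.tdist (blockIter K x) b : ℝ) - 1)) :=
        hD0.trans (le_max_left _ _)
      have h := hblk P rfl hPL hK₀M hK1 hK hN3 hε S A hec hle hreg x y₀ (blockPiece K b g) M _
        (blockPiece_supported b g hy₀) (fun y => (norm_blockPiece_apply_le b g y).trans (hgM y)) hDb0 (blockDist_le hK x b g hD)
      exact h.trans (mul_le_mul_of_nonneg_right (mul_le_mul_of_nonneg_left (exp_blockDist_split hK₀r x b) (by positivity)) hM0)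
    · rw [blockPiece_eq_zero_of_empty b g hb, smul_zero, map_zero, Pi.zero_apply, norm_zero]
      positivity
  refine (Finset.sum_le_sum fun b _ => hpiece b).trans ?_
  rw [← Finset.sum_mul, ← Finset.mul_sum, ← Finset.mul_sum]
  have hsum := sum_exp_neg_tdist_le (P := P) (k := K) hrate (blockIter K x)
  calc c₀ * P.mesh K ^ 2 * (Real.exp (-(D / (4 * K₀ * (P.L : ℝ) ^ K))) * Real.exp (1 / (4 * K₀))
          * ∑ b : HiggsLattice.Site P K, Real.exp (-(1 / (4 * K₀) * (HiggsLattice.Site.tdist (blockIter K x) b : ℝ)))) * M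
      ≤ c₀ * P.mesh K ^ 2 * (Real.exp (-(D / (4 * K₀ * (P.L : ℝ) ^ K))) * Real.exp (1 / (4 * K₀))
          * latticeConst P.d (1 / (4 * K₀))) * M :=
        mul_le_mul_of_nonneg_right (mul_le_mul_of_nonneg_left (mul_le_mul_of_nonneg_left hsum (by positivity)) (by positivity)) hM0
    _ = c₀ * Real.exp (1 / (4 * K₀)) * latticeConst P.d (1 / (4 * K₀)) * P.mesh K ^ 2
          * Real.exp (-(D / (4 * K₀ * (P.L : ℝ) ^ K))) * M := by ring

set_option maxHeartbeats 800000 in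
/-- **PROP. 2.1 (2.25), DERIVATIVE MEMBER, FOR CELL-PRODUCT BOXES OF BIG BLOCKS WITHOUT `R₀`, ARBITRARY `g`** — p35 g15's
`B1Ineq225RegularBox.norm_covDeriv_propagatorK_box_reg_decay` (EVERY bond `⟨x, x+εe_μ⟩` with both ends in `Ω`) summed over the `K`-blocks:
`‖(D^ε_A G^ε_K(Ω, A)1_Ωg)(⟨x, μ⟩)‖ ≤ c₁(K₀)(L^Kε)·e^{−D/(4K₀L^K)}·M′`.
[cite: Balaban1982Higgs1, Prop. 2.1 (2.23), (2.25) p.610, p.611 l.1–2] [cite: Balaban1983RegularityDecay, Theorem (1.10) p.573, (2.21)–(2.22)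
pp.578–579, p.579 L25–28] -/
theorem norm_covDeriv_propagatorK_box_reg_decay_sum (d L : ℕ) (hd : 1 ≤ d) (hL : 2 ≤ L) {a : ℝ} (ha : 0 < a) {msq : ℝ}
    (hmsq : 0 < msq) (N : ℕ) (C : ChargeData N) (ε₀ : ℝ) (creg β : ℝ) (hcreg : 0 ≤ creg) (hβ : 0 < β) :
    ∃ K₀min : ℕ, ∀ K₀ : ℕ, K₀min ≤ K₀ → ∃ c₀ e₁ : ℝ, 0 < c₀ ∧ 0 < e₁ ∧
      ∀ (P : HiggsLattice.Params), P.d = d → P.L = L → K₀ ∣ P.M →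
      ∀ {K : ℕ}, 1 ≤ K → K ≤ P.K → (∀ μ, 3 * half P K K₀ ≤ P.sitesPerDir 0 μ) → P.mesh K ≤ ε₀ →
      ∀ (S : Fin P.d → Finset ℕ) (A : HiggsLattice.VecField P 0) {ec : ℝ}, 0 < ec → ec ≤ e₁ →
      (∀ z ∈ cellBox K K₀ S, ∀ μ ν : Fin P.d,
          P.mesh K * |C.e| / ec * |A ⟨z.shift μ, ν⟩ - A ⟨z, ν⟩| ≤ creg * ec ^ (β - 1) / (P.L : ℝ) ^ K) →
      ∀ (x : HiggsLattice.Site P 0) (μ : Fin P.d), x ∈ cellBox K K₀ S → x.shift μ ∈ cellBox K K₀ S →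
        ∀ (g : ScalarField P 0 N) (M D : ℝ), (∀ y, ‖g y‖ ≤ M) → 0 ≤ D →
          (∀ z, g z ≠ 0 → D ≤ (HiggsLattice.Site.tdist x z : ℝ)) →
            ‖covDeriv C A (propagatorK C (cellBox K K₀ S) A msq a K (chi (cellBox K K₀ S) • g)) ⟨x, μ⟩‖
              ≤ c₀ * P.mesh K * Real.exp (-(D / (4 * K₀ * (P.L : ℝ) ^ K))) * M := by
  obtain ⟨c₀, hc₀, K₀min, hmain⟩ :=
    B1Ineq225RegularBox.norm_covDeriv_propagatorK_box_reg_decay d L hd hL ha hmsq N C ε₀ creg β hcreg hβ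
  refine ⟨max K₀min 1, fun K₀ hK₀ => ?_⟩
  have hK₀1 : 1 ≤ K₀ := le_trans (le_max_right _ _) hK₀
  have hK₀r : (0 : ℝ) < K₀ := by exact_mod_cast hK₀1
  obtain ⟨e₁, he₁, hblk⟩ := hmain K₀ (le_trans (le_max_left _ _) hK₀)
  have hrate : (0 : ℝ) < 1 / (4 * K₀) := by positivity
  have hlc : 0 < latticeConst d (1 / (4 * K₀)) := latticeConst_pos' hd hrate
  refine ⟨c₀ * Real.exp (1 / (4 * K₀)) * latticeConst d (1 / (4 * K₀)), e₁, by positivity, he₁, ?_⟩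
  intro P hPd hPL hK₀M K hK1 hK hN3 hε S A ec hec hle hreg x μ hxΩ hsΩ g M D hgM hD0 hD
  subst hPd
  have hM0 : 0 ≤ M := (norm_nonneg _).trans (hgM x)
  have hmK0 : 0 < P.mesh K := P.mesh_pos K
  have hLK : (0 : ℝ) < (P.L : ℝ) ^ K := pow_pos (by exact_mod_cast P.hL) K
  have hsplit : covDeriv C A (propagatorK C (cellBox K K₀ S) A msq a K (chi (cellBox K K₀ S) • g)) ⟨x, μ⟩
      = ∑ b : HiggsLattice.Site P K,
          covDeriv C A (propagatorK C (cellBox K K₀ S) A msq a K (chi (cellBox K K₀ S) • blockPiece K b g)) ⟨x, μ⟩ := by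
    conv_lhs => rw [← sum_blockPiece (K := K) g]
    rw [Finset.smul_sum, map_sum, covDeriv_sum']
  rw [hsplit]
  refine (norm_sum_le _ _).trans ?_
  have hpiece : ∀ b : HiggsLattice.Site P K,
      ‖covDeriv C A (propagatorK C (cellBox K K₀ S) A msq a K (chi (cellBox K K₀ S) • blockPiece K b g)) ⟨x, μ⟩‖
      ≤ c₀ * P.mesh K * (Real.exp (-(D / (4 * K₀ * (P.L : ℝ) ^ K))) * Real.exp (1 / (4 * K₀))
          * Real.exp (-(1 / (4 * K₀) * (HiggsLattice.Site.tdist (blockIter K x) b : ℝ)))) * M := by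
    intro b
    classical
    by_cases hb : ∃ y₀, blockIter K y₀ = b
    · obtain ⟨y₀, hy₀⟩ := hb
      have hDb0 : 0 ≤ max D ((P.L : ℝ) ^ K * ((HiggsLattice.Site.tdist (blockIter K x) b : ℝ) - 1)) :=
        hD0.trans (le_max_left _ _)
      have h := hblk P rfl hPL hK₀M hK1 hK hN3 hε S A hec hle hreg x μ hxΩ hsΩ y₀ (blockPiece K b g) M _
        (blockPiece_supported b g hy₀) (fun y => (norm_blockPiece_apply_le b g y).trans (hgM y)) hDb0 (blockDist_le hK x b g hD)
      exact h.trans (mul_le_mul_of_nonneg_right (mul_le_mul_of_nonneg_left (exp_blockDist_split hK₀r x b) (by positivity)) hM0)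
    · rw [blockPiece_eq_zero_of_empty b g hb, smul_zero, map_zero, covDeriv_zero', norm_zero]
      positivity
  refine (Finset.sum_le_sum fun b _ => hpiece b).trans ?_
  rw [← Finset.sum_mul, ← Finset.mul_sum, ← Finset.mul_sum]
  have hsum := sum_exp_neg_tdist_le (P := P) (k := K) hrate (blockIter K x)
  calc c₀ * P.mesh K * (Real.exp (-(D / (4 * K₀ * (P.L : ℝ) ^ K))) * Real.exp (1 / (4 * K₀))
          * ∑ b : HiggsLattice.Site P K, Real.exp (-(1 / (4 * K₀) * (HiggsLattice.Site.tdist (blockIter K x) b : ℝ)))) * M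
      ≤ c₀ * P.mesh K * (Real.exp (-(D / (4 * K₀ * (P.L : ℝ) ^ K))) * Real.exp (1 / (4 * K₀))
          * latticeConst P.d (1 / (4 * K₀))) * M :=
        mul_le_mul_of_nonneg_right (mul_le_mul_of_nonneg_left (mul_le_mul_of_nonneg_left hsum (by positivity)) (by positivity)) hM0
    _ = c₀ * Real.exp (1 / (4 * K₀)) * latticeConst P.d (1 / (4 * K₀)) * P.mesh K
          * Real.exp (-(D / (4 * K₀ * (P.L : ℝ) ^ K))) * M := by ring

end BoxSum

/-! ## §2 The derivative engine of `B3Ineq210RegularRegion` with a BOND hypothesis (`b₋, b₊ ∈ Ω`) in place of the site predicate -/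

section EngineB

variable (C : ChargeData N) (Ω : Finset (HiggsLattice.Site P 0)) (A : HiggsLattice.VecField P 0) (msq a : ℝ) {l : ℕ}

/-- The decay factor at the block distance (r14's bookkeeping, re-derived: private there). [cite: Balaban1982Higgs1, Prop. 2.1 (2.25) p.610] -/
private theorem exp_blockDist_le'' (x : HiggsLattice.Site P 0) (y : HiggsLattice.Site P l) {δ : ℝ} (hδ : 0 ≤ δ) :
    Real.exp (-(δ * (max 0 ((P.L : ℝ) ^ l * (HiggsLattice.Site.tdist (blockIter l x) y : ℝ) - ((P.L : ℝ) ^ l - 1))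
        / (P.L : ℝ) ^ l)))
      ≤ Real.exp δ * Real.exp (-(δ * (HiggsLattice.Site.tdist (blockIter l x) y : ℝ))) := by
  rw [← Real.exp_add]
  apply Real.exp_le_exp.mpr
  have hT : (0 : ℝ) < (P.L : ℝ) ^ l := pow_pos (by exact_mod_cast P.hL) l
  set t : ℝ := (HiggsLattice.Site.tdist (blockIter l x) y : ℝ) with ht
  have h2 : t - 1 ≤ max 0 ((P.L : ℝ) ^ l * t - ((P.L : ℝ) ^ l - 1)) / (P.L : ℝ) ^ l := by
    rw [le_div_iff₀ hT]
    have h1 : (P.L : ℝ) ^ l * t - ((P.L : ℝ) ^ l - 1) ≤ max 0 ((P.L : ℝ) ^ l * t - ((P.L : ℝ) ^ l - 1)) :=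
      le_max_right _ _
    nlinarith
  nlinarith [mul_le_mul_of_nonneg_left h2 hδ]

/-- **First kernel on a region, differentiated, AT A BOND OF `Ω`** (both ends in `Ω`): `‖(D^ε_AG^ε_l(Ω)Q_l^*e_s)(b)‖ ≤ c_De^{δ}e^{−δ|(b₋)_l − y_s|}√N`
from the (I.2.25) derivative clause in engine form ON THE BONDS OF `Ω` — r14's `norm_covDeriv_G_avgQkAdj_cb_le_R` with the bond hypothesis.
[cite: Balaban1982Higgs1, Prop. 2.1 (2.25) p.610, p.611 l.1–2] -/
theorem norm_covDeriv_G_avgQkAdj_cb_le_B (hl : l ≤ P.K) {cD δ : ℝ} (hcD : 0 ≤ cD) (hδ : 0 ≤ δ)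
    (hDG : ∀ (g : ScalarField P 0 N) (M D : ℝ), (∀ x, ‖g x‖ ≤ M) → 0 ≤ D →
      ∀ b : HiggsLattice.PBond P 0, b.src ∈ Ω → b.tgt ∈ Ω → (∀ z, g z ≠ 0 → D ≤ (HiggsLattice.Site.tdist b.src z : ℝ)) →
        ‖covDeriv C A (propagatorK C Ω A msq a l g) b‖ ≤ cD * Real.exp (-(δ * (D / (P.L : ℝ) ^ l))) * M)
    (s : HiggsLattice.Site P l × Ix N) {b : HiggsLattice.PBond P 0} (hb : b.src ∈ Ω) (hb' : b.tgt ∈ Ω) :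
    ‖covDeriv C A (propagatorK C Ω A msq a l (avgQkAdj C A l (cb P N l s))) b‖
      ≤ cD * Real.exp δ * Real.exp (-(δ * (HiggsLattice.Site.tdist (blockIter l b.src) s.1 : ℝ))) * Real.sqrt N := by
  set D : ℝ := max 0 ((P.L : ℝ) ^ l * (HiggsLattice.Site.tdist (blockIter l b.src) s.1 : ℝ) - ((P.L : ℝ) ^ l - 1)) with hD
  have h := hDG (avgQkAdj C A l (cb P N l s)) (Real.sqrt N) D (norm_avgQkAdj_cb_le C A s) (le_max_left _ _) b hb hb'
    (fun z hz => blockDist_le_tdist hl b.src s.1 (blockIter_eq_of_avgQkAdj_cb_ne_zero C A s hz))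
  refine h.trans ?_
  have he := exp_blockDist_le'' (P := P) b.src s.1 hδ
  have hsq : 0 ≤ Real.sqrt (N : ℝ) := Real.sqrt_nonneg _
  calc cD * Real.exp (-(δ * (D / (P.L : ℝ) ^ l))) * Real.sqrt N
      ≤ cD * (Real.exp δ * Real.exp (-(δ * (HiggsLattice.Site.tdist (blockIter l b.src) s.1 : ℝ)))) * Real.sqrt N :=
        mul_le_mul_of_nonneg_right (mul_le_mul_of_nonneg_left he hcD) hsq
    _ = _ := by ring

/-- **THE SANDWICH KERNEL ON A REGION, DIFFERENTIATED AT A BOND OF `Ω`**: r14's `norm_covDeriv_sandwichR_cb_le` with the site predicate on the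
bond's source replaced by `b₋, b₊ ∈ Ω` (the value-side predicate `good` for the right end `x_q` is kept). The proof is r14's, line by line.
[cite: Balaban1982Higgs1, (2.43) p.612, Prop. 2.1 (2.25) p.610, Prop. 2.3 (2.34) p.611, p.611 l.1–2] -/
theorem norm_covDeriv_sandwichR_cb_le_B (hl : l ≤ P.K) (hmsq : 0 < msq) (hak : 0 ≤ B1.aSeq a P.L l)
    (hΩ : ∀ x x' : HiggsLattice.Site P 0, blockIter l x = blockIter l x' → (x ∈ Ω ↔ x' ∈ Ω))
    {good : HiggsLattice.Site P 0 → Prop} (hgood : ∀ x, good x → x ∈ Ω)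
    {cG cD cC δ : ℝ} (hcG : 0 ≤ cG) (hcD : 0 ≤ cD) (hcC : 0 ≤ cC) (hδ : 0 < δ)
    (hG : ∀ (g : ScalarField P 0 N) (M D : ℝ), (∀ x, ‖g x‖ ≤ M) → 0 ≤ D →
      ∀ x, good x → (∀ z, g z ≠ 0 → D ≤ (HiggsLattice.Site.tdist x z : ℝ)) →
        ‖propagatorK C Ω A msq a l g x‖ ≤ cG * Real.exp (-(δ * (D / (P.L : ℝ) ^ l))) * M)
    (hDG : ∀ (g : ScalarField P 0 N) (M D : ℝ), (∀ x, ‖g x‖ ≤ M) → 0 ≤ D →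
      ∀ b : HiggsLattice.PBond P 0, b.src ∈ Ω → b.tgt ∈ Ω → (∀ z, g z ≠ 0 → D ≤ (HiggsLattice.Site.tdist b.src z : ℝ)) →
        ‖covDeriv C A (propagatorK C Ω A msq a l g) b‖ ≤ cD * Real.exp (-(δ * (D / (P.L : ℝ) ^ l))) * M)
    (hC : ∀ s t : HiggsLattice.Site P l × Ix N, s.1 ∈ levelSet l Ω → t.1 ∈ levelSet l Ω →
      |mat (fluctCovA C Ω A msq a l) s t| ≤ cC * Real.exp (-(δ * (HiggsLattice.Site.tdist s.1 t.1 : ℝ))))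
    {q : HiggsLattice.Site P 0 × Ix N} (hq : good q.1) {b : HiggsLattice.PBond P 0} (hb : b.src ∈ Ω) (hb' : b.tgt ∈ Ω) :
    ‖covDeriv C A (sandwichR C Ω A msq a l (cb P N 0 q)) b‖
      ≤ (cD * Real.exp δ * Real.sqrt N) * (cG * Real.exp δ * Real.sqrt N) * cC * (((P.L : ℝ) ^ l) ^ P.d)⁻¹ *
          profile P N (δ / 2) ^ 2 * Real.exp (δ / 2) *
          Real.exp (-(δ / 2 * ((HiggsLattice.Site.tdist b.src q.1 : ℝ) / (P.L : ℝ) ^ l))) := by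
  have h0 : sandwichR C Ω A msq a l (cb P N 0 q) = (propagatorK C Ω A msq a l ∘ₗ avgQkAdj C A l)
      (fluctCovA C Ω A msq a l (avgQkLin C A l (propagatorK C Ω A msq a l (cb P N 0 q)))) := by
    simp only [sandwichR, LinearMap.comp_apply]
  rw [h0]
  refine (norm_covDeriv_apply_le_sum_coord C A _ _ b).trans ?_
  have hK : 0 ≤ profile P N (δ / 2) := profile_nonneg' _ (by linarith)
  calc ∑ s : HiggsLattice.Site P l × Ix N, |fieldCoord (E N) (HiggsLattice.Site P l)
            (fluctCovA C Ω A msq a l (avgQkLin C A l (propagatorK C Ω A msq a l (cb P N 0 q)))) s| *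
          ‖covDeriv C A ((propagatorK C Ω A msq a l ∘ₗ avgQkAdj C A l) (cb P N l s)) b‖
      ≤ ∑ s : HiggsLattice.Site P l × Ix N,
          (∑ t : HiggsLattice.Site P l × Ix N, cC * Real.exp (-(δ * (HiggsLattice.Site.tdist s.1 t.1 : ℝ))) *
            ((((P.L : ℝ) ^ l) ^ P.d)⁻¹ *
              (cG * Real.exp δ * Real.exp (-(δ * (HiggsLattice.Site.tdist (blockIter l q.1) t.1 : ℝ))) * Real.sqrt N))) *
          (cD * Real.exp δ * Real.exp (-(δ * (HiggsLattice.Site.tdist (blockIter l b.src) s.1 : ℝ))) * Real.sqrt N) := by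
        refine Finset.sum_le_sum fun s _ => ?_
        by_cases hs : s.1 ∈ levelSet l Ω
        · have h1 := (abs_coord_CQG_le_R C Ω A msq a s q).trans
            (sum_CQG_le_R C Ω A msq a hl hmsq hak hΩ hgood hcG hcC hδ.le hG hC hs hq)
          have h2 : ‖covDeriv C A ((propagatorK C Ω A msq a l ∘ₗ avgQkAdj C A l) (cb P N l s)) b‖
              ≤ cD * Real.exp δ * Real.exp (-(δ * (HiggsLattice.Site.tdist (blockIter l b.src) s.1 : ℝ))) * Real.sqrt N := by
            rw [LinearMap.comp_apply]
            exact norm_covDeriv_G_avgQkAdj_cb_le_B C Ω A msq a hl hcD hδ.le hDG s hb hb'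
          exact mul_le_mul h1 h2 (norm_nonneg _) (Finset.sum_nonneg fun t _ => by positivity)
        · have hz : ‖covDeriv C A ((propagatorK C Ω A msq a l ∘ₗ avgQkAdj C A l) (cb P N l s)) b‖ = 0 := by
            have htgt : propagatorK C Ω A msq a l (avgQkAdj C A l (cb P N l s)) b.tgt = 0 :=
              G_avgQkAdj_cb_eq_zero C Ω A msq a hmsq hak hΩ s hs hb'
            rw [LinearMap.comp_apply, B1Cor23RegularRegion.covDeriv_eq,
              G_avgQkAdj_cb_eq_zero C Ω A msq a hmsq hak hΩ s hs hb, htgt]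
            simp
          rw [hz, mul_zero]
          exact mul_nonneg (Finset.sum_nonneg fun t _ => by positivity) (by positivity)
    _ = (cD * Real.exp δ * Real.sqrt N) * (cG * Real.exp δ * Real.sqrt N) * cC * (((P.L : ℝ) ^ l) ^ P.d)⁻¹ *
          ∑ s : HiggsLattice.Site P l × Ix N, ∑ t : HiggsLattice.Site P l × Ix N,
            Real.exp (-(δ * (HiggsLattice.Site.tdist (blockIter l b.src) s.1 : ℝ))) *
              Real.exp (-(δ * (HiggsLattice.Site.tdist s.1 t.1 : ℝ))) *
              Real.exp (-(δ * (HiggsLattice.Site.tdist (blockIter l q.1) t.1 : ℝ))) := by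
        rw [Finset.mul_sum]
        refine Finset.sum_congr rfl fun s _ => ?_
        rw [Finset.sum_mul, Finset.mul_sum]
        refine Finset.sum_congr rfl fun t _ => ?_
        ring
    _ ≤ (cD * Real.exp δ * Real.sqrt N) * (cG * Real.exp δ * Real.sqrt N) * cC * (((P.L : ℝ) ^ l) ^ P.d)⁻¹ *
          (profile P N (δ / 2) ^ 2 *
            Real.exp (-(δ / 2 * (HiggsLattice.Site.tdist (blockIter l b.src) (blockIter l q.1) : ℝ)))) :=
        mul_le_mul_of_nonneg_left (sum3_le hδ (blockIter l b.src) (blockIter l q.1) q.2) (by positivity)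
    _ ≤ (cD * Real.exp δ * Real.sqrt N) * (cG * Real.exp δ * Real.sqrt N) * cC * (((P.L : ℝ) ^ l) ^ P.d)⁻¹ *
          (profile P N (δ / 2) ^ 2 * (Real.exp (δ / 2) *
            Real.exp (-(δ / 2 * ((HiggsLattice.Site.tdist b.src q.1 : ℝ) / (P.L : ℝ) ^ l))))) :=
        mul_le_mul_of_nonneg_left (mul_le_mul_of_nonneg_left (exp_blockIter_le hl hδ.le b.src q.1) (pow_nonneg hK 2))
          (by positivity)
    _ = _ := by ring

end EngineB

/-! ## §2′ The derivative piece bounds with the bond hypothesis -/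

section PieceBoundsB

variable (C : ChargeData N) (Ω : Finset (HiggsLattice.Site P 0)) (A : HiggsLattice.VecField P 0) (msq : ℝ) {a : ℝ} {k j : ℕ}
  {good : HiggsLattice.Site P 0 → Prop}

/-- scaling bookkeeping: `ε^{−d}·L^{−jd} = (L^jε)^{−d}` (r14's, private there). [cite: Balaban1982Higgs1, (1.19) p.607] -/
private theorem inv_mesh_zero_pow_mul' (j : ℕ) :
    (P.mesh 0 ^ P.d)⁻¹ * (((P.L : ℝ) ^ j) ^ P.d)⁻¹ = (P.mesh j ^ P.d)⁻¹ := by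
  rw [mesh_eq_pow_mul P j, mul_pow, mul_inv, mul_comm]

/-- scaling bookkeeping: `(L^jε)^{−n}(L^jε)^{n+m} = (L^jε)^m` (r14's, private there). [cite: Balaban1982Higgs1, (1.19) p.607] -/
private theorem mesh_pow_cancel' (j n m : ℕ) : (P.mesh j ^ n)⁻¹ * P.mesh j ^ (n + m) = P.mesh j ^ m := by
  rw [pow_add, inv_mul_cancel_left₀ (pow_ne_zero _ (P.mesh_pos j).ne')]

/-- **Piece `j = 0` (covariant derivative) AT A BOND OF `Ω`**: `ε^{−d}Σ_{i′}‖(D^ε_AG^ε_1e_{(x′,i′)})(⟨x,μ⟩)‖ ≤ N√N·c₀′L·ε·ε^{−d}·e^{−ρ|x − x′|/L}`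
from the (I.2.25) derivative clause at level `1` on the bonds of `Ω` — r14's `absDG_pieceR_zero_le` with the bond hypothesis.
[cite: Balaban1983Higgs3, (2.6) p.424, (2.10) p.426] [cite: Balaban1982Higgs1, Prop. 2.1 (2.25) p.610, p.611 l.1–2] -/
theorem absDG_pieceR_zero_le_B {c₀' ρ : ℝ}
    (hDG : ∀ (g : ScalarField P 0 N) (M D : ℝ), (∀ x, ‖g x‖ ≤ M) → 0 ≤ D →
      ∀ b : HiggsLattice.PBond P 0, b.src ∈ Ω → b.tgt ∈ Ω → (∀ z, g z ≠ 0 → D ≤ (HiggsLattice.Site.tdist b.src z : ℝ)) →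
        ‖covDeriv C A (propagatorK C Ω A msq a 1 g) b‖
          ≤ c₀' * P.mesh 1 * Real.exp (-(ρ * (D / (P.L : ℝ) ^ 1))) * M)
    (μ : Fin P.d) {x : HiggsLattice.Site P 0} (hx : x ∈ Ω) (hxμ : x.shift μ ∈ Ω) (x' : HiggsLattice.Site P 0) :
    (P.mesh 0 ^ P.d)⁻¹ * ∑ i' : Ix N, ‖covDeriv C A (pieceR C Ω A msq a k 0 (cb P N 0 (x', i'))) ⟨x, μ⟩‖
      ≤ ((N : ℝ) * Real.sqrt N * c₀' * (P.L : ℝ)) * (P.mesh 0 * (P.mesh 0 ^ P.d)⁻¹) *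
          Real.exp (-(ρ * ((HiggsLattice.Site.tdist x x' : ℝ) / (P.L : ℝ) ^ 1))) := by
  have h1 : ∀ i' : Ix N, ‖covDeriv C A (pieceR C Ω A msq a k 0 (cb P N 0 (x', i'))) ⟨x, μ⟩‖
      ≤ c₀' * P.mesh 1 * Real.exp (-(ρ * ((HiggsLattice.Site.tdist x x' : ℝ) / (P.L : ℝ) ^ 1))) * Real.sqrt N := by
    intro i'
    rw [pieceR_zero]
    exact hDG (cb P N 0 (x', i')) (Real.sqrt N) (HiggsLattice.Site.tdist x x') (norm_cb_le _) (Nat.cast_nonneg _) ⟨x, μ⟩ hx hxμ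
      (fun z hz => by rw [eq_of_cb_ne_zero _ hz])
  have hsum : ∑ i' : Ix N, ‖covDeriv C A (pieceR C Ω A msq a k 0 (cb P N 0 (x', i'))) ⟨x, μ⟩‖
      ≤ N * (c₀' * P.mesh 1 * Real.exp (-(ρ * ((HiggsLattice.Site.tdist x x' : ℝ) / (P.L : ℝ) ^ 1))) * Real.sqrt N) := by
    refine (Finset.sum_le_sum fun i' _ => h1 i').trans ?_
    rw [Finset.sum_const, card_Ix, nsmul_eq_mul]
  refine (mul_le_mul_of_nonneg_left hsum (inv_nonneg.mpr (pow_nonneg (P.mesh_pos 0).le _))).trans (le_of_eq ?_)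
  rw [mesh_eq_pow_mul P 1, pow_one]
  ring

set_option maxHeartbeats 400000 in
/-- **Piece `1 ≤ j < k` (covariant derivative) AT A BOND OF `Ω`**: r14's `absDG_pieceR_pos_le` with the site predicate on the bond's source
replaced by `x, x+εe_μ ∈ Ω`; the right end `x′` is a `good` point of the value inputs.  The scaling is r14's «rescaling from the η-lattice to
the L^{−j}-lattice»: `ε^{−d}·a_j²(L^jε)^{−4}·(L^jε)^{1+2+2}·L^{−jd} = a_j²(L^jε)^{1−d}`.
[cite: Balaban1983Higgs3, (2.6) p.424, (2.10) p.426] [cite: Balaban1982Higgs1, (2.43) p.612, p.611 l.1–2] -/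
theorem absDG_pieceR_pos_le_B (ha : 0 < a) (hL1 : 1 < P.L) (hj1 : 1 ≤ j) (hjk : j < k) (hjK : j ≤ P.K) (hmsq : 0 < msq)
    (hΩ : ∀ x x' : HiggsLattice.Site P 0, blockIter j x = blockIter j x' → (x ∈ Ω ↔ x' ∈ Ω)) (hgood : ∀ x, good x → x ∈ Ω)
    {c₀ c₀' c₁ δ : ℝ} (hc₀ : 0 ≤ c₀) (hc₀' : 0 ≤ c₀') (hc₁ : 0 ≤ c₁) (hδ : 0 < δ)
    (hG : ∀ (g : ScalarField P 0 N) (M D : ℝ), (∀ x, ‖g x‖ ≤ M) → 0 ≤ D →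
      ∀ x, good x → (∀ z, g z ≠ 0 → D ≤ (HiggsLattice.Site.tdist x z : ℝ)) →
        ‖propagatorK C Ω A msq a j g x‖ ≤ c₀ * P.mesh j ^ 2 * Real.exp (-(δ * (D / (P.L : ℝ) ^ j))) * M)
    (hDG : ∀ (g : ScalarField P 0 N) (M D : ℝ), (∀ x, ‖g x‖ ≤ M) → 0 ≤ D →
      ∀ b : HiggsLattice.PBond P 0, b.src ∈ Ω → b.tgt ∈ Ω → (∀ z, g z ≠ 0 → D ≤ (HiggsLattice.Site.tdist b.src z : ℝ)) →
        ‖covDeriv C A (propagatorK C Ω A msq a j g) b‖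
          ≤ c₀' * P.mesh j * Real.exp (-(δ * (D / (P.L : ℝ) ^ j))) * M)
    (hC : ∀ s t : HiggsLattice.Site P j × Ix N, s.1 ∈ levelSet j Ω → t.1 ∈ levelSet j Ω →
      |mat (fluctCovA C Ω A msq a j) s t| ≤ c₁ * P.mesh j ^ 2 * Real.exp (-(δ * (HiggsLattice.Site.tdist s.1 t.1 : ℝ))))
    (μ : Fin P.d) {x x' : HiggsLattice.Site P 0} (hx : x ∈ Ω) (hxμ : x.shift μ ∈ Ω) (hx' : good x') :
    (P.mesh 0 ^ P.d)⁻¹ * ∑ i' : Ix N, ‖covDeriv C A (pieceR C Ω A msq a k j (cb P N 0 (x', i'))) ⟨x, μ⟩‖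
      ≤ ((N : ℝ) ^ 2 * a ^ 2 * (c₀' * c₀) * c₁ * (Real.exp δ ^ 2 * Real.exp (δ / 2) * profile P N (δ / 2) ^ 2)) *
        (P.mesh j * (P.mesh j ^ P.d)⁻¹) *
          Real.exp (-(δ / 2 * ((HiggsLattice.Site.tdist x x' : ℝ) / (P.L : ℝ) ^ j))) := by
  set X := Real.exp (-(δ / 2 * ((HiggsLattice.Site.tdist x x' : ℝ) / (P.L : ℝ) ^ j))) with hX
  have hm0 : 0 < P.mesh 0 := P.mesh_pos 0
  have hmj : 0 < P.mesh j := P.mesh_pos j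
  have hLj : (0 : ℝ) < (P.L : ℝ) ^ j := pow_pos (by exact_mod_cast P.hL) j
  have hDG' : ∀ (g : ScalarField P 0 N) (M D : ℝ), (∀ x, ‖g x‖ ≤ M) → 0 ≤ D →
      ∀ b : HiggsLattice.PBond P 0, b.src ∈ Ω → b.tgt ∈ Ω → (∀ z, g z ≠ 0 → D ≤ (HiggsLattice.Site.tdist b.src z : ℝ)) →
        ‖covDeriv C A (propagatorK C Ω A msq a j g) b‖ ≤ (c₀' * P.mesh j) * Real.exp (-(δ * (D / (P.L : ℝ) ^ j))) * M :=
    fun g M D hg hD b hb hb' hs => hDG g M D hg hD b hb hb' hs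
  have hG' : ∀ (g : ScalarField P 0 N) (M D : ℝ), (∀ x, ‖g x‖ ≤ M) → 0 ≤ D →
      ∀ x, good x → (∀ z, g z ≠ 0 → D ≤ (HiggsLattice.Site.tdist x z : ℝ)) →
        ‖propagatorK C Ω A msq a j g x‖ ≤ (c₀ * P.mesh j ^ 2) * Real.exp (-(δ * (D / (P.L : ℝ) ^ j))) * M :=
    fun g M D hg hD x hx hs => hG g M D hg hD x hx hs
  have hC' : ∀ s t : HiggsLattice.Site P j × Ix N, s.1 ∈ levelSet j Ω → t.1 ∈ levelSet j Ω →
      |mat (fluctCovA C Ω A msq a j) s t| ≤ (c₁ * P.mesh j ^ 2) * Real.exp (-(δ * (HiggsLattice.Site.tdist s.1 t.1 : ℝ))) :=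
    fun s t hs ht => hC s t hs ht
  have hsw : ∀ i' : Ix N, ‖covDeriv C A (pieceR C Ω A msq a k j (cb P N 0 (x', i'))) ⟨x, μ⟩‖
      ≤ coeff221 P a j ^ 2 * ((c₀' * P.mesh j * Real.exp δ * Real.sqrt N) * (c₀ * P.mesh j ^ 2 * Real.exp δ * Real.sqrt N) *
          (c₁ * P.mesh j ^ 2) * (((P.L : ℝ) ^ j) ^ P.d)⁻¹ * profile P N (δ / 2) ^ 2 * Real.exp (δ / 2) * X) := by
    intro i'
    rw [pieceR_of_pos hj1 hjk, LinearMap.smul_apply, covDeriv_smul'', norm_smul, Real.norm_eq_abs,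
      abs_of_nonneg (sq_nonneg _)]
    exact mul_le_mul_of_nonneg_left
      (norm_covDeriv_sandwichR_cb_le_B C Ω A msq a hjK hmsq (B1.aSeq_pos ha (by exact_mod_cast hL1) hj1).le hΩ hgood
        (by positivity) (by positivity) (by positivity) hδ hG' hDG' hC' (q := (x', i')) hx' (b := ⟨x, μ⟩) hx hxμ)
      (sq_nonneg _)
  have hsum : ∑ i' : Ix N, ‖covDeriv C A (pieceR C Ω A msq a k j (cb P N 0 (x', i'))) ⟨x, μ⟩‖
      ≤ N * (coeff221 P a j ^ 2 * ((c₀' * P.mesh j * Real.exp δ * Real.sqrt N) *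
          (c₀ * P.mesh j ^ 2 * Real.exp δ * Real.sqrt N) *
          (c₁ * P.mesh j ^ 2) * (((P.L : ℝ) ^ j) ^ P.d)⁻¹ * profile P N (δ / 2) ^ 2 * Real.exp (δ / 2) * X)) := by
    refine (Finset.sum_le_sum fun i' _ => hsw i').trans ?_
    rw [Finset.sum_const, card_Ix, nsmul_eq_mul]
  refine (mul_le_mul_of_nonneg_left hsum (inv_nonneg.mpr (pow_nonneg hm0.le _))).trans ?_
  rw [B1Eq243HiggsModel.coeff221_sq]
  have hre : (c₀' * P.mesh j * Real.exp δ * Real.sqrt N) * (c₀ * P.mesh j ^ 2 * Real.exp δ * Real.sqrt N)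
      = c₀' * c₀ * P.mesh j ^ 3 * Real.exp δ ^ 2 * N := by
    have h := Real.mul_self_sqrt (Nat.cast_nonneg N : (0 : ℝ) ≤ N)
    calc (c₀' * P.mesh j * Real.exp δ * Real.sqrt N) * (c₀ * P.mesh j ^ 2 * Real.exp δ * Real.sqrt N)
        = c₀' * c₀ * P.mesh j ^ 3 * Real.exp δ ^ 2 * (Real.sqrt N * Real.sqrt N) := by ring
      _ = _ := by rw [h]
  rw [hre]
  have hid : (P.mesh 0 ^ P.d)⁻¹ * (N * (B1.aSeq a (P.L : ℝ) j ^ 2 * (P.mesh j ^ 4)⁻¹ *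
        (c₀' * c₀ * P.mesh j ^ 3 * Real.exp δ ^ 2 * N * (c₁ * P.mesh j ^ 2) *
          (((P.L : ℝ) ^ j) ^ P.d)⁻¹ * profile P N (δ / 2) ^ 2 * Real.exp (δ / 2) * X)))
      = B1.aSeq a (P.L : ℝ) j ^ 2 * (((N : ℝ) ^ 2 * (c₀' * c₀) * c₁ *
          (Real.exp δ ^ 2 * Real.exp (δ / 2) * profile P N (δ / 2) ^ 2)) * (P.mesh j * (P.mesh j ^ P.d)⁻¹) * X) := by
    calc (P.mesh 0 ^ P.d)⁻¹ * (N * (B1.aSeq a (P.L : ℝ) j ^ 2 * (P.mesh j ^ 4)⁻¹ *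
          (c₀' * c₀ * P.mesh j ^ 3 * Real.exp δ ^ 2 * N * (c₁ * P.mesh j ^ 2) *
            (((P.L : ℝ) ^ j) ^ P.d)⁻¹ * profile P N (δ / 2) ^ 2 * Real.exp (δ / 2) * X)))
        = B1.aSeq a (P.L : ℝ) j ^ 2 * (((N : ℝ) ^ 2 * (c₀' * c₀) * c₁ *
            (Real.exp δ ^ 2 * Real.exp (δ / 2) * profile P N (δ / 2) ^ 2)) * X) *
            ((P.mesh 0 ^ P.d)⁻¹ * (((P.L : ℝ) ^ j) ^ P.d)⁻¹) * ((P.mesh j ^ 4)⁻¹ * P.mesh j ^ (4 + 1)) := by ring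
      _ = _ := by rw [inv_mesh_zero_pow_mul', mesh_pow_cancel', pow_one]; ring
  rw [hid]
  have hrest : 0 ≤ ((N : ℝ) ^ 2 * (c₀' * c₀) * c₁ * (Real.exp δ ^ 2 * Real.exp (δ / 2) * profile P N (δ / 2) ^ 2)) *
      (P.mesh j * (P.mesh j ^ P.d)⁻¹) * X := by
    have hK : 0 ≤ profile P N (δ / 2) := profile_nonneg' _ (by linarith)
    positivity
  calc B1.aSeq a (P.L : ℝ) j ^ 2 * (((N : ℝ) ^ 2 * (c₀' * c₀) * c₁ *
          (Real.exp δ ^ 2 * Real.exp (δ / 2) * profile P N (δ / 2) ^ 2)) * (P.mesh j * (P.mesh j ^ P.d)⁻¹) * X)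
      ≤ a ^ 2 * (((N : ℝ) ^ 2 * (c₀' * c₀) * c₁ *
          (Real.exp δ ^ 2 * Real.exp (δ / 2) * profile P N (δ / 2) ^ 2)) * (P.mesh j * (P.mesh j ^ P.d)⁻¹) * X) :=
        mul_le_mul_of_nonneg_right (aSeq_sq_le ha hL1 hj1) hrest
    _ = _ := by ring

end PieceBoundsB

/-! ## §3 (2.10) PROVED for cell-product boxes at a regular non-constant background, EVERY pair of points -/

section MainB

open B2Eq337ScalarIntegration (Regions)
open B2Eq328ConcretePieces (pieceF)

/-- weakening in the exponent. [folklore] -/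
private theorem exp_le_exp_of_le'' {u v : ℝ} (h : v ≤ u) : Real.exp (-u) ≤ Real.exp (-v) :=
  Real.exp_le_exp.mpr (neg_le_neg h)

/-- p35's rate `D/(4K₀L^l)` dominates a common rate `δ ≤ 1/(4K₀)` (r14's bookkeeping, private there). [cite: Balaban1982Higgs1, Prop. 2.1 (2.25) p.610] -/
private theorem exp_p35_le' {K₀ l : ℕ} (hK₀ : 0 < K₀) {δ D : ℝ} (hδ : δ ≤ 1 / (4 * K₀)) (hD : 0 ≤ D) (hLl : (0 : ℝ) < (P.L : ℝ) ^ l) :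
    Real.exp (-(D / (4 * K₀ * (P.L : ℝ) ^ l))) ≤ Real.exp (-(δ * (D / (P.L : ℝ) ^ l))) := by
  apply exp_le_exp_of_le''
  have hK : (0 : ℝ) < 4 * K₀ := by positivity
  have h1 : D / (4 * K₀ * (P.L : ℝ) ^ l) = 1 / (4 * K₀) * (D / (P.L : ℝ) ^ l) := by
    field_simp
  rw [h1]
  exact mul_le_mul_of_nonneg_right hδ (by positivity)

set_option maxHeartbeats 1600000 in
/-- **B3 (2.10) p. 426 ON A CELL-PRODUCT BOX OF BIG BLOCKS AT A REGULAR NON-CONSTANT BACKGROUND, EVERY PAIR OF POINTS, ONE SMALLNESS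
PARAMETER — the kernel bounds in the model's natural units.**  For `d ≥ 1`, `L ≥ 2`, `a, m² > 0`, `N` and EVERY charge there is a threshold
`K₀,min` and, for every `K₀ ≥ K₀,min`, constants `t, δ, C > 0` with: for every volume `P` with these `d, L` and `K₀ ∣ M`, every scale
`1 ≤ k ≤ K` with `L^kε ≤ 1` and `3L^kK₀ ≤ |T_ε|_μ`, every cell-product box `Ω = cellBox k K₀ S ⊆ T_ε` and every `A` that is `δ_A`-regular ON `Ω`
with `L^kδ_A·|e| ≤ t`: for every piece `j` and EVERY `x, x′ ∈ Ω`,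
`ε^{−d}Σ_{i′}‖(G^η_{(j)}(Ω,A)e_{(x′,i′)})(x)‖ ≤ C·(L^jε)²(L^jε)^{−d}·e^{−δ|x−x′|/L^j}`, and for every `μ` with `x + εe_μ ∈ Ω` the covariant derivative
of the same kernel at `⟨x, x+εe_μ⟩` is `≤ C·(L^jε)(L^jε)^{−d}·e^{−δ|x−x′|/L^j}` — NO interior margin ([Balaban1982Higgs1] p. 611 l.1–2).
Route = `B3Ineq210RegularRegion.ineq210_regularRegion_small` with the (I.2.25) inputs replaced by the `R₀`-free box members (§1) read at every
level `l ≤ k` through `cellBox_eq_cellBox_of_le`, and the derivative pieces through §2.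
[cite: Balaban1983Higgs3, (2.6) p.424, (2.10) p.426] [cite: Balaban1982Higgs1, Prop. 2.1 (2.23), (2.25) p.610, p.611 l.1–2, Prop. 2.3 (2.34) p.611,
(2.43) p.612] -/
theorem pieceR_box_bounds_small (d L : ℕ) (hd : 1 ≤ d) (hL : 2 ≤ L) {a : ℝ} (ha : 0 < a) {msq : ℝ} (hmsq : 0 < msq)
    (N : ℕ) (C : ChargeData N) :
    ∃ K₀min : ℕ, ∀ K₀ : ℕ, K₀min ≤ K₀ → ∃ t δ₁ Cst : ℝ, 0 < t ∧ 0 < δ₁ ∧ 0 < Cst ∧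
      ∀ (P : HiggsLattice.Params), 1 < P.L → P.d = d → P.L = L → K₀ ∣ P.M →
      ∀ {k : ℕ}, 1 ≤ k → k ≤ P.K → (∀ μ, 3 * half P k K₀ ≤ P.sitesPerDir 0 μ) → P.mesh k ≤ 1 →
      ∀ (S : Fin P.d → Finset ℕ) (A : HiggsLattice.VecField P 0) {δA : ℝ}, 0 ≤ δA →
        (∀ z ∈ cellBox k K₀ S, ∀ μ ν : Fin P.d, |A ⟨z.shift ν, μ⟩ - A ⟨z, μ⟩| ≤ δA) →
        (P.L : ℝ) ^ k * δA * |C.e| ≤ t →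
        ∀ (j : ℕ) (x x' : HiggsLattice.Site P 0), x ∈ cellBox k K₀ S → x' ∈ cellBox k K₀ S →
          (P.mesh 0 ^ P.d)⁻¹ * ∑ i' : Ix N, ‖pieceR C (cellBox k K₀ S) A msq a k j (cb P N 0 (x', i')) x‖
              ≤ Cst * (P.mesh j ^ 2 * (P.mesh j ^ P.d)⁻¹) *
                Real.exp (-(δ₁ * ((HiggsLattice.Site.tdist x x' : ℝ) / (P.L : ℝ) ^ j))) ∧
          ∀ μ : Fin P.d, x.shift μ ∈ cellBox k K₀ S →
            (P.mesh 0 ^ P.d)⁻¹ * ∑ i' : Ix N, ‖covDeriv C A (pieceR C (cellBox k K₀ S) A msq a k j (cb P N 0 (x', i'))) ⟨x, μ⟩‖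
              ≤ Cst * (P.mesh j * (P.mesh j ^ P.d)⁻¹) *
                Real.exp (-(δ₁ * ((HiggsLattice.Site.tdist x x' : ℝ) / (P.L : ℝ) ^ j))) := by
  have hL1 : 1 < L := by omega
  obtain ⟨t₀, c₁, ρ₃, ht₀, hc₁, hρ₃, hCov⟩ := B1Prop23RegularRegionSmall.prop23_regular_region_small d L hL1 ha hmsq N
  obtain ⟨K₁, hV⟩ := norm_propagatorK_box_reg_decay_sum d L hd hL ha hmsq N C 1 1 1 zero_le_one one_pos
  obtain ⟨K₂, hD⟩ := norm_covDeriv_propagatorK_box_reg_decay_sum d L hd hL ha hmsq N C 1 1 1 zero_le_one one_pos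
  refine ⟨max (max K₁ K₂) 1, fun K₀ hK₀ => ?_⟩
  have hK₁ : K₁ ≤ K₀ := ((le_max_left _ _).trans (le_max_left _ _)).trans hK₀
  have hK₂ : K₂ ≤ K₀ := ((le_max_right _ _).trans (le_max_left _ _)).trans hK₀
  have hK₀1 : 1 ≤ K₀ := (le_max_right _ _).trans hK₀
  obtain ⟨c₀, e₁, hc₀, he₁, hV⟩ := hV K₀ hK₁
  obtain ⟨c₀', e₂, hc₀', he₂, hD⟩ := hD K₀ hK₂
  -- the common rate, the smallness threshold and the constant
  obtain ⟨δ, hδ⟩ : ∃ δ : ℝ, δ = min (1 / (4 * (K₀ : ℝ))) ρ₃ := ⟨_, rfl⟩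
  have hδpos : 0 < δ := by rw [hδ]; exact lt_min (by positivity) hρ₃
  have hδ₁ : δ ≤ 1 / (4 * K₀) := by rw [hδ]; exact min_le_left _ _
  have hδ₃ : δ ≤ ρ₃ := by rw [hδ]; exact min_le_right _ _
  have hLpos : (0 : ℝ) < L := by exact_mod_cast (by omega : 0 < L)
  refine ⟨min (min e₁ e₂) t₀, δ / (2 * L), cst210 d L N a c₀ c₀' c₁ δ, lt_min (lt_min he₁ he₂) ht₀, div_pos hδpos (by positivity),
    cst210_pos hc₀.le hc₀'.le hc₁.le, ?_⟩
  intro P hP1 hPd hPL hK₀M k hk1 hkK h3 hmesh S A δA hδA hreg ht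
  subst hPd hPL
  set Ω : Finset (HiggsLattice.Site P 0) := cellBox k K₀ S with hΩdef
  have hL1' : 1 < P.L := hP1
  have hLr : 1 < (P.L : ℝ) := by exact_mod_cast hL1'
  have hLge1 : (1 : ℝ) ≤ P.L := hLr.le
  have hCst : 0 ≤ cst210 P.d P.L N a c₀ c₀' c₁ δ := (cst210_pos hc₀.le hc₀'.le hc₁.le).le
  have hte₁ : (P.L : ℝ) ^ k * δA * |C.e| ≤ e₁ := ht.trans ((min_le_left _ _).trans (min_le_left _ _))
  have hte₂ : (P.L : ℝ) ^ k * δA * |C.e| ≤ e₂ := ht.trans ((min_le_left _ _).trans (min_le_right _ _))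
  have htt₀ : (P.L : ℝ) ^ k * δA * |C.e| ≤ t₀ := ht.trans (min_le_right _ _)
  have hΩ : IsBigBlockUnion k K₀ Ω := isBigBlockUnion_cellBox S
  -- block-union facts at every level `l ≤ k`
  have hΩl : ∀ {l : ℕ}, l ≤ k → ∀ x x' : HiggsLattice.Site P 0, blockIter l x = blockIter l x' → (x ∈ Ω ↔ x' ∈ Ω) :=
    fun hl => blockUnion_of_isBigBlockUnion hl hΩ
  -- the box at level `l`
  have hΩeq : ∀ {l : ℕ}, l ≤ k → cellBox l K₀ (refineS P k l S) = Ω := fun hl => (cellBox_eq_cellBox_of_le hl S).symm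
  -- (I.2.25) value at level `l`, engine form, at EVERY point of `Ω`
  have hGl : ∀ {l : ℕ}, 1 ≤ l → l ≤ k → ∀ (g : ScalarField P 0 N) (M D : ℝ), (∀ x, ‖g x‖ ≤ M) → 0 ≤ D →
      ∀ x, x ∈ Ω → (∀ z, g z ≠ 0 → D ≤ (HiggsLattice.Site.tdist x z : ℝ)) →
        ‖propagatorK C Ω A msq a l g x‖ ≤ c₀ * P.mesh l ^ 2 * Real.exp (-(δ * (D / (P.L : ℝ) ^ l))) * M := by
    intro l hl1 hlk g M D hg hD0 x hx hsupp
    have hmesh_l : P.mesh l ≤ 1 := (mesh_mono P hlk).trans hmesh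
    have h3l : ∀ μ, 3 * half P l K₀ ≤ P.sitesPerDir 0 μ := fun μ => (Nat.mul_le_mul_left _ (half_mono hlk)).trans (h3 μ)
    have hak : 0 ≤ B1.aSeq a P.L l := (B1.aSeq_pos ha hLr hl1).le
    have h0 := hV P rfl rfl hK₀M hl1 (hlk.trans hkK) h3l hmesh_l (refineS P k l S) A he₁ le_rfl
    rw [hΩeq hlk] at h0
    have h := h0 (reg223R_of_small C Ω A hlk hmesh_l he₁ hδA hreg hte₁ le_rfl) x g M D hg hD0 hsupp
    rw [← propagatorK_apply_eq_chi C A hmsq hak (hΩl hlk) g hx] at h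
    refine h.trans ?_
    have hM : 0 ≤ M := (norm_nonneg _).trans (hg x)
    have hLl : (0 : ℝ) < (P.L : ℝ) ^ l := pow_pos (by exact_mod_cast P.hL) l
    have hexp := exp_p35_le' (P := P) (by omega : 0 < K₀) hδ₁ hD0 hLl
    exact mul_le_mul_of_nonneg_right (mul_le_mul_of_nonneg_left hexp (by positivity)) hM
  -- (I.2.25) derivative at level `l`, at EVERY bond of `Ω`
  have hDl : ∀ {l : ℕ}, 1 ≤ l → l ≤ k → ∀ (g : ScalarField P 0 N) (M D : ℝ), (∀ x, ‖g x‖ ≤ M) → 0 ≤ D →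
      ∀ b : HiggsLattice.PBond P 0, b.src ∈ Ω → b.tgt ∈ Ω → (∀ z, g z ≠ 0 → D ≤ (HiggsLattice.Site.tdist b.src z : ℝ)) →
        ‖covDeriv C A (propagatorK C Ω A msq a l g) b‖
          ≤ c₀' * P.mesh l * Real.exp (-(δ * (D / (P.L : ℝ) ^ l))) * M := by
    intro l hl1 hlk g M D hg hD0 b hb hb' hsupp
    have hmesh_l : P.mesh l ≤ 1 := (mesh_mono P hlk).trans hmesh
    have h3l : ∀ μ, 3 * half P l K₀ ≤ P.sitesPerDir 0 μ := fun μ => (Nat.mul_le_mul_left _ (half_mono hlk)).trans (h3 μ)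
    have hak : 0 ≤ B1.aSeq a P.L l := (B1.aSeq_pos ha hLr hl1).le
    have h0 := hD P rfl rfl hK₀M hl1 (hlk.trans hkK) h3l hmesh_l (refineS P k l S) A he₂ le_rfl
    rw [hΩeq hlk] at h0
    have h := h0 (reg223R_of_small C Ω A hlk hmesh_l he₂ hδA hreg hte₂ le_rfl) b.src b.dir hb hb' g M D hg hD0 hsupp
    -- `G(1_Ωg)` and `Gg` agree on `Ω ∋ b₋, b₊`
    have hcut : ∀ y ∈ Ω, propagatorK C Ω A msq a l (chi Ω • g) y = propagatorK C Ω A msq a l g y :=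
      fun y hy => (propagatorK_apply_eq_chi C A hmsq hak (hΩl hlk) g hy).symm
    have hbb : (⟨b.src, b.dir⟩ : HiggsLattice.PBond P 0) = b := rfl
    rw [hbb] at h
    have hb'' : covDeriv C A (propagatorK C Ω A msq a l (chi Ω • g)) b
        = covDeriv C A (propagatorK C Ω A msq a l g) b := by
      have h1 : propagatorK C Ω A msq a l (chi Ω • g) b.tgt = propagatorK C Ω A msq a l g b.tgt := hcut _ hb'
      have h2 : propagatorK C Ω A msq a l (chi Ω • g) b.src = propagatorK C Ω A msq a l g b.src := hcut _ hb
      rw [B1Cor23RegularRegion.covDeriv_eq, B1Cor23RegularRegion.covDeriv_eq, h1, h2]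
    rw [hb''] at h
    refine h.trans ?_
    have hM : 0 ≤ M := (norm_nonneg _).trans (hg b.src)
    have hml : 0 < P.mesh l := P.mesh_pos l
    have hLl : (0 : ℝ) < (P.L : ℝ) ^ l := pow_pos (by exact_mod_cast P.hL) l
    have hexp := exp_p35_le' (P := P) (by omega : 0 < K₀) hδ₁ hD0 hLl
    exact mul_le_mul_of_nonneg_right (mul_le_mul_of_nonneg_left hexp (by positivity)) hM
  -- (I.2.34) at level `l < k` on `Ω^{(l)} × Ω^{(l)}`, ONE SMALLNESS PARAMETER (p35's `prop23_regular_region_small`)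
  have hCl : ∀ {l : ℕ}, 1 ≤ l → l < k → ∀ s t : HiggsLattice.Site P l × Ix N, s.1 ∈ levelSet l Ω → t.1 ∈ levelSet l Ω →
      |mat (fluctCovA C Ω A msq a l) s t| ≤ c₁ * P.mesh l ^ 2 * Real.exp (-(δ * (HiggsLattice.Site.tdist s.1 t.1 : ℝ))) := by
    intro l hl1 hlk s t hs ht'
    obtain ⟨j, rfl⟩ : ∃ j, l = j + 1 := ⟨l - 1, by omega⟩
    have hmesh_l : P.mesh (j + 1) ≤ 1 := (mesh_mono P hlk.le).trans hmesh
    have hjK : j + 1 < P.K := lt_of_lt_of_le hlk hkK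
    have htl : (P.L : ℝ) ^ (j + 1) * δA * |C.e| ≤ t₀ := by
      have hpow : (P.L : ℝ) ^ (j + 1) ≤ (P.L : ℝ) ^ k := pow_le_pow_right₀ hLge1 hlk.le
      have h0 : 0 ≤ δA * |C.e| := by positivity
      calc (P.L : ℝ) ^ (j + 1) * δA * |C.e| = (P.L : ℝ) ^ (j + 1) * (δA * |C.e|) := by ring
        _ ≤ (P.L : ℝ) ^ k * (δA * |C.e|) := mul_le_mul_of_nonneg_right hpow h0
        _ = (P.L : ℝ) ^ k * δA * |C.e| := by ring
        _ ≤ t₀ := htt₀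
    have hjk : j < k := by omega
    have hpf : pieceF (towerR Ω k) ⟨j, hjk⟩ = Ω := pieceF_towerR ⟨j, hjk⟩ (hΩl hlk.le)
    have hregF : ∀ z ∈ pieceF (towerR Ω k) ⟨j, hjk⟩, ∀ μ' ν : Fin P.d, |A ⟨z.shift ν, μ'⟩ - A ⟨z, μ'⟩| ≤ δA := by
      rw [hpf]; exact hreg
    have hj2 : j + 2 ≤ k := by omega
    have hΛ := levelSet_blockUnion hjK.le (hΩl hlk.le) (hΩl hj2)
    have h := (hCov C P rfl rfl (towerR Ω k) hkK ⟨j, hjk⟩ hjK hmesh_l hΛ A hδA hregF htl (Λ := levelSet (j + 1) Ω)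
      (subset_refl _) hs ht').1
    rw [hpf, mat_condCov232_levelSet C A hjK.le hmsq ha hLr (hΩl hlk.le) (hΩl hj2) hs] at h
    refine h.trans ?_
    have hexp : Real.exp (-(ρ₃ * (HiggsLattice.Site.tdist s.1 t.1 : ℝ))) ≤ Real.exp (-(δ * (HiggsLattice.Site.tdist s.1 t.1 : ℝ))) :=
      exp_le_exp_of_le'' (mul_le_mul_of_nonneg_right hδ₃ (Nat.cast_nonneg _))
    calc P.mesh (j + 1) ^ 2 * c₁ * Real.exp (-(ρ₃ * (HiggsLattice.Site.tdist s.1 t.1 : ℝ)))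
        ≤ P.mesh (j + 1) ^ 2 * c₁ * Real.exp (-(δ * (HiggsLattice.Site.tdist s.1 t.1 : ℝ))) :=
          mul_le_mul_of_nonneg_left hexp (by positivity)
      _ = _ := by ring
  -- rate bookkeeping
  have hrate : δ / (2 * P.L) ≤ δ / 2 := by
    rw [div_le_div_iff₀ (by positivity) (by norm_num : (0 : ℝ) < 2)]
    nlinarith
  have hexp0 : ∀ x x' : HiggsLattice.Site P 0,
      Real.exp (-(δ * ((HiggsLattice.Site.tdist x x' : ℝ) / (P.L : ℝ) ^ 1)))
        ≤ Real.exp (-(δ / (2 * P.L) * ((HiggsLattice.Site.tdist x x' : ℝ) / (P.L : ℝ) ^ 0))) := by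
    intro x x'
    apply exp_le_exp_of_le''
    rw [pow_one, pow_zero, div_one]
    have h0 : 0 ≤ δ * ((HiggsLattice.Site.tdist x x' : ℝ) / P.L) := by positivity
    calc δ / (2 * P.L) * (HiggsLattice.Site.tdist x x' : ℝ) = (1 / 2) * (δ * ((HiggsLattice.Site.tdist x x' : ℝ) / P.L)) := by
          ring
      _ ≤ δ * ((HiggsLattice.Site.tdist x x' : ℝ) / P.L) := by linarith
  have hexpj : ∀ (j : ℕ) (x x' : HiggsLattice.Site P 0),
      Real.exp (-(δ / 2 * ((HiggsLattice.Site.tdist x x' : ℝ) / (P.L : ℝ) ^ j)))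
        ≤ Real.exp (-(δ / (2 * P.L) * ((HiggsLattice.Site.tdist x x' : ℝ) / (P.L : ℝ) ^ j))) :=
    fun j x x' => exp_le_exp_of_le'' (mul_le_mul_of_nonneg_right hrate (by positivity))
  have hgood : ∀ x, x ∈ Ω → x ∈ Ω := fun x hx => hx
  intro j x x' hx hx'
  refine ⟨?_, fun μ hxμ => ?_⟩
  · have hmj : 0 < P.mesh j := P.mesh_pos j
    rcases Nat.eq_zero_or_pos j with rfl | hj1
    · refine (absG_pieceR_zero_le C Ω A msq (k := k) (good := fun y => y ∈ Ω) (hGl le_rfl hk1) hx x').trans ?_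
      exact mul_le_mul (mul_le_mul_of_nonneg_right (le_cst210_zero hc₀.le hc₀'.le hc₁.le) (by positivity)) (hexp0 x x')
        (Real.exp_pos _).le (by positivity)
    · by_cases hjk : j < k
      · refine (absG_pieceR_pos_le C Ω A msq ha hL1' hj1 hjk (hjk.le.trans hkK) hmsq (hΩl hjk.le) (good := fun y => y ∈ Ω) hgood
          hc₀.le hc₁.le hδpos (hGl hj1 hjk.le) (hCl hj1 hjk) hx hx').trans ?_
        exact mul_le_mul (mul_le_mul_of_nonneg_right (le_cst210_pos hc₀.le hc₀'.le hc₁.le) (by positivity)) (hexpj j x x')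
          (Real.exp_pos _).le (by positivity)
      · rw [absG_pieceR_ge_eq_zero C Ω A msq hj1 (not_lt.mp hjk)]
        positivity
  · have hmj : 0 < P.mesh j := P.mesh_pos j
    rcases Nat.eq_zero_or_pos j with rfl | hj1
    · refine (absDG_pieceR_zero_le_B C Ω A msq (k := k) (hDl le_rfl hk1) μ hx hxμ x').trans ?_
      exact mul_le_mul (mul_le_mul_of_nonneg_right (le_cst210_zero' hc₀.le hc₀'.le hc₁.le) (by positivity)) (hexp0 x x')
        (Real.exp_pos _).le (by positivity)
    · by_cases hjk : j < k
      · refine (absDG_pieceR_pos_le_B C Ω A msq ha hL1' hj1 hjk (hjk.le.trans hkK) hmsq (hΩl hjk.le) (good := fun y => y ∈ Ω) hgood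
          hc₀.le hc₀'.le hc₁.le hδpos (hGl hj1 hjk.le) (hDl hj1 hjk.le) (hCl hj1 hjk) μ hx hxμ hx').trans ?_
        exact mul_le_mul (mul_le_mul_of_nonneg_right (le_cst210_pos' hc₀.le hc₀'.le hc₁.le) (by positivity)) (hexpj j x x')
          (Real.exp_pos _).le (by positivity)
      · rw [absDG_pieceR_ge_eq_zero C Ω A msq hj1 (not_lt.mp hjk)]
        positivity

end MainB

/-! ## §4 The carrier on the box and `Ineq210` for it; the statement in print's units -/

/-- **The concrete carrier of B3 (2.10) on a CELL-PRODUCT BOX `Ω = cellBox k K₀ S ⊆ T_η` at a regular non-constant background `B̃ = A`**: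
sites = ALL points of `Ω` (no margin); `dist = ε|x − x′|`; `absG j x x′ = ε^{−d}Σ_{i′}‖(G^η_{(j)}(Ω,A)e_{(x′,i′)})(x)‖`, the kernel of the piece
`pieceR` of (2.6) for the region operators `G^ε_j(Ω,A)`, `C^{(j)}(Ω,A)`; `absDG j μ x x′` its covariant derivative (I.1.7) in the row variable at
the bond `⟨x, x+εe_μ⟩` when that bond lies in `Ω` — the Neumann operator of `Ω` ((I.2.17)) has exactly these bonds — and `0` (nothing claimed)
otherwise; the fields of (2.5), (2.11), (2.12) are not modelled (`0`).
[cite: Balaban1983Higgs3, (2.6) p.424, (2.10) p.426] [cite: Balaban1982Higgs1, Prop. 2.1 p.610, p.611 l.1–2] -/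
def regBoxKernels {P : HiggsLattice.Params} {N : ℕ} (hL1 : 1 < P.L) (C : ChargeData N) (S : Fin P.d → Finset ℕ)
    (A : HiggsLattice.VecField P 0) (msq a : ℝ) (k K₀ : ℕ) : ScaledKernels where
  Site := {x : HiggsLattice.Site P 0 // x ∈ cellBox k K₀ S}
  Bond := HiggsLattice.PBond P 0
  Dir := Fin P.d
  LocFn := PUnit
  dist := fun x x' => P.mesh 0 * (HiggsLattice.Site.tdist x.1 x'.1 : ℝ)
  dist2 := fun _ _ _ => 0
  distBlock := fun _ _ _ => 0
  distSupp := fun _ _ => 0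
  distΩ₂ := 0
  L := P.L
  η := P.mesh 0
  d := P.d
  eRun := 0
  pRun := 0
  one_lt_L := by exact_mod_cast hL1
  η_pos := P.mesh_pos 0
  absG := fun j x x' => (P.mesh 0 ^ P.d)⁻¹ * ∑ i' : Ix N, ‖pieceR C (cellBox k K₀ S) A msq a k j (cb P N 0 (x'.1, i')) x.1‖
  absDG := fun j μ x x' => by
    classical
    exact if x.1.shift μ ∈ cellBox k K₀ S then
      (P.mesh 0 ^ P.d)⁻¹ * ∑ i' : Ix N, ‖covDeriv C A (pieceR C (cellBox k K₀ S) A msq a k j (cb P N 0 (x'.1, i'))) ⟨x.1, μ⟩‖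
    else 0
  holderDiff := fun _ _ _ _ _ => 0
  absGavg := fun _ _ _ => 0
  normDeltaG := fun _ _ _ => 0
  norm116 := fun _ _ _ _ _ => 0

section CarrierB

variable {hL1 : 1 < P.L} {C : ChargeData N} {S : Fin P.d → Finset ℕ} {A : HiggsLattice.VecField P 0} {msq a : ℝ} {k K₀ : ℕ}

/-- the carrier's `L^jη` is the model's `L^jε`. [cite: Balaban1983Higgs3, (2.10) p.426] -/
theorem scaleB_eq (j : ℕ) : (regBoxKernels hL1 C S A msq a k K₀).scale j = P.mesh j := by
  show (P.L : ℝ) ^ j * P.mesh 0 = P.mesh j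
  rw [mesh_eq_pow_mul P j]

/-- kernel: `(L^jη)^{2−d} = (L^jη)²·((L^jη)^d)^{−1}`. [folklore] -/
private theorem rpow_two_sub'' (j : ℕ) : P.mesh j ^ ((2 : ℝ) - (P.d : ℝ)) = P.mesh j ^ 2 * (P.mesh j ^ P.d)⁻¹ := by
  rw [Real.rpow_sub (P.mesh_pos j), div_eq_mul_inv, Real.rpow_natCast _ P.d, Real.rpow_two]

/-- kernel: `(L^jη)^{1−d} = (L^jη)·((L^jη)^d)^{−1}`. [folklore] -/
private theorem rpow_one_sub'' (j : ℕ) : P.mesh j ^ ((1 : ℝ) - (P.d : ℝ)) = P.mesh j * (P.mesh j ^ P.d)⁻¹ := by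
  rw [Real.rpow_sub (P.mesh_pos j), div_eq_mul_inv, Real.rpow_natCast _ P.d, Real.rpow_one]

/-- kernel: `(L^jη)^{−1}·(ε|x − x′|) = |x − x′|/L^j`. [folklore] -/
private theorem scale_inv_mul_dist'' (j : ℕ) (x x' : HiggsLattice.Site P 0) :
    (P.mesh j)⁻¹ * (P.mesh 0 * (HiggsLattice.Site.tdist x x' : ℝ)) = (HiggsLattice.Site.tdist x x' : ℝ) / (P.L : ℝ) ^ j := by
  rw [mesh_eq_pow_mul P j, mul_inv, mul_assoc, ← mul_assoc (P.mesh 0)⁻¹, inv_mul_cancel₀ (P.mesh_pos 0).ne', one_mul,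
    div_eq_inv_mul]

/-- **Transfer**: kernel bounds at all points of the box (value) and at all bonds of the box (derivative) give `Ineq210` for the box carrier.
[cite: Balaban1983Higgs3, (2.10) p.426] -/
theorem ineq210_of_boundsB {δ₁ Cst : ℝ} (hCst : 0 ≤ Cst)
    (hvd : ∀ (j : ℕ) (x x' : HiggsLattice.Site P 0), x ∈ cellBox k K₀ S → x' ∈ cellBox k K₀ S →
      (P.mesh 0 ^ P.d)⁻¹ * ∑ i' : Ix N, ‖pieceR C (cellBox k K₀ S) A msq a k j (cb P N 0 (x', i')) x‖
        ≤ Cst * (P.mesh j ^ 2 * (P.mesh j ^ P.d)⁻¹) *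
          Real.exp (-(δ₁ * ((HiggsLattice.Site.tdist x x' : ℝ) / (P.L : ℝ) ^ j))) ∧
      ∀ μ : Fin P.d, x.shift μ ∈ cellBox k K₀ S →
        (P.mesh 0 ^ P.d)⁻¹ * ∑ i' : Ix N, ‖covDeriv C A (pieceR C (cellBox k K₀ S) A msq a k j (cb P N 0 (x', i'))) ⟨x, μ⟩‖
          ≤ Cst * (P.mesh j * (P.mesh j ^ P.d)⁻¹) *
            Real.exp (-(δ₁ * ((HiggsLattice.Site.tdist x x' : ℝ) / (P.L : ℝ) ^ j)))) :
    (regBoxKernels hL1 C S A msq a k K₀).Ineq210 δ₁ Cst := by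
  intro j x x'
  have e1 : (regBoxKernels hL1 C S A msq a k K₀).absG j x x'
      = (P.mesh 0 ^ P.d)⁻¹ * ∑ i' : Ix N, ‖pieceR C (cellBox k K₀ S) A msq a k j (cb P N 0 (x'.1, i')) x.1‖ := rfl
  have e3 : (regBoxKernels hL1 C S A msq a k K₀).dist x x' = P.mesh 0 * (HiggsLattice.Site.tdist x.1 x'.1 : ℝ) := rfl
  have e4 : (regBoxKernels hL1 C S A msq a k K₀).d = P.d := rfl
  rw [scaleB_eq, e1, e3, e4, rpow_two_sub'', rpow_one_sub'', mul_assoc δ₁, scale_inv_mul_dist'']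
  obtain ⟨hv, hd⟩ := hvd j x.1 x'.1 x.2 x'.2
  refine ⟨hv, fun μ => ?_⟩
  classical
  by_cases hμ : x.1.shift μ ∈ cellBox k K₀ S
  · have e2 : (regBoxKernels hL1 C S A msq a k K₀).absDG j μ x x'
        = (P.mesh 0 ^ P.d)⁻¹ * ∑ i' : Ix N, ‖covDeriv C A (pieceR C (cellBox k K₀ S) A msq a k j (cb P N 0 (x'.1, i'))) ⟨x.1, μ⟩‖ := by
      show (if x.1.shift μ ∈ cellBox k K₀ S then _ else _) = _
      rw [if_pos hμ]
    rw [e2]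
    exact hd μ hμ
  · have e2 : (regBoxKernels hL1 C S A msq a k K₀).absDG j μ x x' = 0 := by
      show (if x.1.shift μ ∈ cellBox k K₀ S then _ else _) = _
      rw [if_neg hμ]
    rw [e2]
    have hmj : 0 < P.mesh j := P.mesh_pos j
    positivity

/-- **B3 (2.10) p. 426 [PDF 16] PROVED ON A CELL-PRODUCT BOX OF BIG BLOCKS AT A REGULAR NON-CONSTANT BACKGROUND `B̃ = A`, EVERY PAIR OF
POINTS, ONE SMALLNESS PARAMETER, uniformly in the volume.**  For `d ≥ 1`, `L ≥ 2`, `a, m² > 0`, `N` and EVERY charge there is a threshold `K₀,min`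
and, for every `K₀ ≥ K₀,min`, constants `t, δ₁, C > 0` with: for every volume `P` with these `d, L` and `K₀ ∣ M`, every scale `1 ≤ k ≤ K` with
`L^kε ≤ 1` and `3L^kK₀ ≤ |T_ε|_μ`, every cell-product box `Ω = cellBox k K₀ S` (cells of `L^kK₀` fine sites; products of intervals of big blocks,
also wrapping the torus; the whole torus, `cellBox_univ`) and every configuration `A` that is `δ_A`-regular ON `Ω` with `L^kδ_A|e| ≤ t`
(print's *"for e(L^kε) sufficiently small"*): `(regBoxKernels _ C S A m² a k K₀).Ineq210 δ₁ C` — (2.10) and its differentiated form for all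
`j` and ALL `x, x′ ∈ Ω` (the derivative at every bond of `Ω`).  This is the parallelepiped clause of Prop. I.2.1 — *«For some simple sets Ω,
e.g. for rectangular parallelepipeds, the inequalities hold without any restrictions on the points x, x′»* (p. 611 l.1–2) — carried through
print's «rescaling … and application of Propositions I.2.1 and I.2.3».  Honest scope: module docstring.
[cite: Balaban1983Higgs3, (2.6) p.424, (2.10) p.426] [cite: Balaban1982Higgs1, Prop. 2.1 (2.23), (2.25) p.610, p.611 l.1–2, Prop. 2.3 (2.34)
p.611, (2.43) p.612] -/
theorem ineq210_regularBox_small (d L : ℕ) (hd : 1 ≤ d) (hL : 2 ≤ L) {a : ℝ} (ha : 0 < a) {msq : ℝ} (hmsq : 0 < msq)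
    (N : ℕ) (C : ChargeData N) :
    ∃ K₀min : ℕ, ∀ K₀ : ℕ, K₀min ≤ K₀ → ∃ t δ₁ Cst : ℝ, 0 < t ∧ 0 < δ₁ ∧ 0 < Cst ∧
      ∀ (P : HiggsLattice.Params) (hP1 : 1 < P.L), P.d = d → P.L = L → K₀ ∣ P.M →
      ∀ {k : ℕ}, 1 ≤ k → k ≤ P.K → (∀ μ, 3 * half P k K₀ ≤ P.sitesPerDir 0 μ) → P.mesh k ≤ 1 →
      ∀ (S : Fin P.d → Finset ℕ) (A : HiggsLattice.VecField P 0) {δA : ℝ}, 0 ≤ δA →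
        (∀ z ∈ cellBox k K₀ S, ∀ μ ν : Fin P.d, |A ⟨z.shift ν, μ⟩ - A ⟨z, μ⟩| ≤ δA) →
        (P.L : ℝ) ^ k * δA * |C.e| ≤ t →
        (regBoxKernels hP1 C S A msq a k K₀).Ineq210 δ₁ Cst := by
  obtain ⟨K₀min, h⟩ := pieceR_box_bounds_small d L hd hL ha hmsq N C
  refine ⟨K₀min, fun K₀ hK₀ => ?_⟩
  obtain ⟨t, δ₁, Cst, ht, hδ₁, hCst, h⟩ := h K₀ hK₀
  refine ⟨t, δ₁, Cst, ht, hδ₁, hCst, ?_⟩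
  intro P hP1 hPd hPL hK₀M k hk1 hkK h3 hmesh S A δA hδA hreg ht'
  exact ineq210_of_boundsB hCst.le (h P hP1 hPd hPL hK₀M hk1 hkK h3 hmesh S A hδA hreg ht')

/-- **The same, un-subtyped, in print's units**: (2.10) on the box for every piece `j`, the VALUE clause at EVERY `x, x′ ∈ Ω` with
`O(1)(L^jη)^{2−d}e^{−δ₁(L^jη)^{−1}|x−x′|}` and the DERIVATIVE clause at every bond `⟨x, x+εe_μ⟩ ⊂ Ω` with the additional factor `(L^jη)^{−1}` —
the form consumed by kernel bookkeeping over all sites of `Ω` (r14's (1.16) programme, box step).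
[cite: Balaban1983Higgs3, (2.10) p.426] [cite: Balaban1982Higgs1, Prop. 2.1 (2.23) p.610, p.611 l.1–2] -/
theorem ineq210_regularBox_explicit_small (d L : ℕ) (hd : 1 ≤ d) (hL : 2 ≤ L) {a : ℝ} (ha : 0 < a) {msq : ℝ} (hmsq : 0 < msq)
    (N : ℕ) (C : ChargeData N) :
    ∃ K₀min : ℕ, ∀ K₀ : ℕ, K₀min ≤ K₀ → ∃ t δ₁ Cst : ℝ, 0 < t ∧ 0 < δ₁ ∧ 0 < Cst ∧
      ∀ (P : HiggsLattice.Params), 1 < P.L → P.d = d → P.L = L → K₀ ∣ P.M →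
      ∀ {k : ℕ}, 1 ≤ k → k ≤ P.K → (∀ μ, 3 * half P k K₀ ≤ P.sitesPerDir 0 μ) → P.mesh k ≤ 1 →
      ∀ (S : Fin P.d → Finset ℕ) (A : HiggsLattice.VecField P 0) {δA : ℝ}, 0 ≤ δA →
        (∀ z ∈ cellBox k K₀ S, ∀ μ ν : Fin P.d, |A ⟨z.shift ν, μ⟩ - A ⟨z, μ⟩| ≤ δA) →
        (P.L : ℝ) ^ k * δA * |C.e| ≤ t →
        ∀ (j : ℕ) (x x' : HiggsLattice.Site P 0), x ∈ cellBox k K₀ S → x' ∈ cellBox k K₀ S →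
          (P.mesh 0 ^ P.d)⁻¹ * ∑ i' : Ix N, ‖pieceR C (cellBox k K₀ S) A msq a k j (cb P N 0 (x', i')) x‖
              ≤ Cst * P.mesh j ^ ((2 : ℝ) - (P.d : ℝ)) *
                Real.exp (-(δ₁ * (P.mesh j)⁻¹ * (P.mesh 0 * (HiggsLattice.Site.tdist x x' : ℝ)))) ∧
          ∀ μ : Fin P.d, x.shift μ ∈ cellBox k K₀ S →
            (P.mesh 0 ^ P.d)⁻¹ * ∑ i' : Ix N, ‖covDeriv C A (pieceR C (cellBox k K₀ S) A msq a k j (cb P N 0 (x', i'))) ⟨x, μ⟩‖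
              ≤ Cst * P.mesh j ^ ((1 : ℝ) - (P.d : ℝ)) *
                Real.exp (-(δ₁ * (P.mesh j)⁻¹ * (P.mesh 0 * (HiggsLattice.Site.tdist x x' : ℝ)))) := by
  obtain ⟨K₀min, h⟩ := pieceR_box_bounds_small d L hd hL ha hmsq N C
  refine ⟨K₀min, fun K₀ hK₀ => ?_⟩
  obtain ⟨t, δ₁, Cst, ht, hδ₁, hCst, h⟩ := h K₀ hK₀
  refine ⟨t, δ₁, Cst, ht, hδ₁, hCst, ?_⟩
  intro P hP1 hPd hPL hK₀M k hk1 hkK h3 hmesh S A δA hδA hreg ht' j x x' hx hx'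
  obtain ⟨hv, hdd⟩ := h P hP1 hPd hPL hK₀M hk1 hkK h3 hmesh S A hδA hreg ht' j x x' hx hx'
  rw [rpow_two_sub'', rpow_one_sub'', mul_assoc δ₁, scale_inv_mul_dist'']
  exact ⟨hv, hdd⟩

/-- **Non-vacuity / the torus as a box**: with `S_μ = [0, |T_ε|_μ)` the box is the whole torus, every point of which satisfies the conclusion —
so `ineq210_regularBox_explicit_small` contains the every-point torus statement (r14's `ineq210_regularRegion_univ_small`, reached there through
`interior_univ`), and its hypotheses are met by every `K₀`-tiled volume of r14's `B3Ineq210RegularRegion.regularRegion_small_hypotheses_nonvacuous`.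
[cite: Balaban1982Higgs1, Prop. 2.1 p.611 («The same considerations apply to Ω = T^{(k)}_1»)] -/
theorem mem_cellBox_univ (k K₀ : ℕ) (x : HiggsLattice.Site P 0) :
    x ∈ cellBox k K₀ (fun μ => Finset.range (P.sitesPerDir 0 μ)) := by
  rw [cellBox_univ]; exact Finset.mem_univ x

end CarrierB





end Literature.MathematicalPhysics.QuantumFieldTheory.Balaban1983to89.B3Ineq210RegularBox

end
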